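import Summits.CriticalPhenomena.PercolationContinuityZ3.Theses.PercBurnResprinkle
import Literature.Probability.Percolation.PercolationProofs

/-!
# Disproof of `VacantReignition` — findings (standing adversary, crux stmt-CriticalPhenomena-7203)

Work file of the crux disprover (route `PercBurnResprinkle`, sub-problem `PercolationContinuityZ3`).
Prose lives in docstrings; everything below is `lean check`ed (rc 0, 0 sorry, axioms ⊆ the standard 3).

## Findings (cycle 1, 2026-08-15)

* **Elaboration audit — no junk.** `labelMeasure V = Measure.infinitePi (fun _ ↦ volume.restrict (Icc 0 1))`;
  Mathlib defines `infinitePi μ := if ∀ i, IsProbabilityMeasure (μ i) then … else 0`, and the condition HOLDS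
  (`isProbabilityMeasure_volume_restrict_unitInterval`, a theorem of `PercolationProofs.lean`, not a
  registered instance) — so the label fields are genuine i.i.d. uniforms and `labelMeasure ⊗ labelMeasure` is a
  genuine probability measure (`instIsProbabilityMeasureμ2`).  `bondPercolation = setBer(E, p)` is Mathlib's
  product Bernoulli measure, `zdGraph 3 = hasse (Fin 3 → ℤ)` is the nearest-neighbour lattice
  (`zdGraph_adj_iff`), `criticalProb` is Grimmett's `p_c` (harmless `∪ {1}` convention), quantifier order
  matches the informal text (`∀ ε ∃ p`).  Hence the crux is the honest open problem "ℤ³ recovers from fires"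
  in vacant-set / fresh-field form: the `d = 3` case of [ADKS2015 = arXiv:1302.6872, Thm 2, p. 3: "for every
  ε > 0 and d sufficiently large there exists p > p_c such that ω_{p_c+ε} ∖ C_∞(ω_p) contains an infinite
  cluster a.s." and the remark after it: "the critical probability for percolation on the random graph obtained
  from ℤ^d by removing a sufficiently thin supercritical cluster is a.s. at most p_c + ε"], explicitly left
  open for ℤ³ [ADKS2015 p. 4: the one-arm bound is `≥ c r^{-1}` in ℤ³, "the approach used here has no hope of
  working in ℤ³ (though … this does not preclude the possibility that ℤ³ does recover from fires)"].  The
  differences from ADKS (independent fresh field; VERTEX removal) do not change the status.  No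
  formalisation-level refutation exists.
* **(a) Load-bearing hypotheses.** The only hypothesis is `0 < ε`; dropping it makes the crux FALSE
  (`vacantReignition_false_without_eps_pos`: at field level `p_c - 2 < 0` the fresh field is a.s. empty).
  The side condition `p_c < p` is what makes the statement non-trivial (with `p < 0` the burnt set is a.s.
  empty and the event is plain supercritical percolation of the fresh field — positive direction, not
  formalised here).
* **(b) Structure / tightness.** The event is antitone in the environment level `p` and monotone in the field
  level `q` (`reignites_anti`, `reignites_mono_level`): `∃ p > p_c` ⟺ `for all p close enough to p_c`
  (`vacantReignition_iff_eventually`).  For `p ≥ 1` the event is NULL (`reignites_null_of_one_le`: burnt set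
  = a.s. all of `ℤ³`), so the strengthening "for EVERY `p > p_c`" is false (`not_vacantReignitionAllP`) and any
  witness lives in `(p_c, 1)`.
* **(b'') THE DIAGONAL IS NULL and THE RESAMPLING IDENTITY (proved, cycle 1½; ≈ 1000 checked lines).**
  `reignites_null_of_level_le : q ≤ p → μ2 (reignites p q) = 0` and at every root at once
  `vacantFresh_noPercolation_of_level_le`: a fresh Bernoulli(`q`) field with `q ≤ p` a.s. never percolates
  off the burnt set `I_p` — the weak fire-break `p_c(ℤ³ ∖ I_p) ≥ p` for EVERY real `p`, no uniqueness, no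
  `θ`-information.  Stronger, for ALL `p, q`: `measure_reignitesAt_eq_same : μ2 (reignitesAt p q x) =
  labelMeasure (sameReignitesAt p q x)` — the two-field (fresh) reignition event and the ONE-field event
  "the environment's own level-`q` edges off `I_p` percolate from `x`" have equal probability; hence
  `vacantReignition_iff_sameField`: the crux is LITERALLY the `d = 3`, vertex-deleted, rooted form of ADKS
  Thm 2 in the standard monotone coupling (one field), settling the route header's doubt ("conditional law
  not exactly product").  Proof: finite-volume proxy `I^N = {y ∈ Λ_N : y ↔ ∂Λ_N in Λ_N}`; locality
  `{I^N = S} ∈ σ(p-bits of pairs of Λ_N touching S)` (`INset_eq_of_bits`, two walk inductions);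
  independence of disjointly determined finite-bit events under `labelMeasure`
  (`measure_inter_eq_mul_of_detBy`, from Mathlib's `iIndepFun_infinitePi`) gives the elementary strong-Markov
  identity `μ2 (A_M^N) = P (B_M^N)` (`measure_AMN_eq_BMN`); `I^N ↓ I_p` on finite windows with
  `P(y ↔ ∂Λ_N) ↓ P(C(y) = ∞)` (`tendsto_TB`, `measure_compl_Good_le`) transports it to the honest burnt set
  (`measure_AM_eq_BM`) and continuity from above to the percolation events; on the diagonal the one-field
  event is squeezed (`BMN_subset`) / EMPTY (`sameReignitesAt_eq_empty_of_level_le`).  Consequences: the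
  witness WINDOW `vacantReignition_iff_window` (`VacantReignition ⟺ ∀ ε > 0 ∃ p ∈ (p_c, p_c+ε) …`), the
  load-bearing `vacantReignition_false_without_window`, and `jumpFireBreak_conclusion_at_eps_zero` (the
  conclusion of the sister crux 7204 holds at `ε = 0` unconditionally: 7204 IS the strict increment).
  These are the `ShellIdentity` / `DiagonalVanishes` / `WeakFireBreak` / `HolesAreFresh` facts the crux
  ideators proposed as first lemmas (cards explore-from-infinity, holes-are-fresh) — proved here for the
  events the crux needs, without conditional laws.
* **(c) Natural strengthenings.** `ε = 0` (fresh field exactly at `p_c`) forces a JUMP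
  (`jump_of_vacantReignitionAtCriticalLevel`; generally `μ2.real (reignites p q) ≤ θ(q)`, `real_reignites_le_theta`),
  so it is false in the continuity world (`not_vacantReignitionAtCriticalLevel_of_continuity`): the crux is
  sharp at `ε = 0` modulo the conjecture itself.  The quantifier swap `UniformReignition` (one `p > p_c` for
  all `ε > 0`, i.e. `p_c(ℤ³ ∖ I_p) = p_c(ℤ³)` with reignition at every supercritical level) is stated below
  WITHOUT verdict: expected false by Aizenman–Grimmett heuristics for this environment, but AG strictness is
  FALSE for general stationary positive-density deletions (random parallel planes `D = ℤ² × S`: slabs of all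
  widths survive, `p_c(ℤ³ ∖ D) = p_c` by Grimmett–Marstrand) — not cheaply decidable either way.
* **(c') The `Cages` failure mode, deterministic toy.** `finite_openCluster_of_walls_deleted`: if the
  deleted set contains `walls n = {x | ∃ i, n ∣ x_i}` (three families of lattice planes, density `≤ 3/n`,
  as small as desired) then EVERY cluster of EVERY configuration on the remaining vertices is finite (the
  cell index `⌊x_i/n⌋` is invariant along vacant edges); `not_mem_reignites_of_walls_subset_burnt`: on
  `{walls n ⊆ I_p(U)}` reignition fails surely.  Moral for provers: no argument using only `θ(p) → 0`
  (smallness of the burnt density) can give S0/S1 — sheets inside `I_p` must be excluded at every scale;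
  moral for disprovers: a kill needs `I_p` to contain a cage system around the origin a.s. for all `p`
  near `p_c`, the 3-D analogue of planar duality, for which there is no evidence.
* **Kill chain made formal.** `VacantReignition → VacantSetPercolates` (`vacantSetPercolates_of_vacantReignition`,
  via `map_configOfLabels_holds` and `Measure.le_map_apply`), so a refutation of the rank-4 crux S0 would refute
  this crux (`not_vacantReignition_of_not_vacantSetPercolates`).  But S0 is Grimmett–Holroyd–Kozma's question
  [GHK2014 = arXiv:1303.1657, §1 p. 3: `p_fin ≥ p_c`; Thm 1: `p_c < p_fin` for `d ≥ 19`; "In d = 3 dimensions, it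
  is natural to expect the strict inequality p_c < p_fin … We do not know whether or not p_c < p_fin for
  3 ≤ d ≤ 18"], expected TRUE; the planar obstruction [KMS2015 = arXiv:1312.7004, Thm 1: planar lattices do not
  recover; GHK p. 3: `p_fin = p_c` in `d = 2` by duality] is absent in `d = 3`.
* **Monte Carlo falsifier (route docblock, CHEAPEST FALSIFIER) — PENDING**: jobs `j004791` (self-test) and
  `j004829` (torus `(ℤ/L)³`, `L ∈ {32,…,128}`, `p = p_c + δ`, `δ ∈ {0.005,…,0.16}`, 32 seeds: burn the giant
  cluster; S0 = giant/wrapping component of the vacant induced subgraph; S1 = Newman–Ziff wrapping threshold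
  `q_wrap` of a fresh field on the vacant set vs controls (full torus → `p_c`; iid deletion of equal size)).
  Prediction recorded BEFORE the run: `Δ_vac(δ) = med q_wrap[vac] − med q_wrap[ctrl]` decreases to `0` with
  `δ` (recovery), `Δ_vac < Δ_iid` at equal density, S0 wraps at every `(L, δ)` with `L ≫ ξ(p)`.  A plateau
  `Δ_vac ≥ c > 0` as `δ → 0` at `L ≫ ξ(p)` would be the 3-D Kiss–Manolescu–Sidoravicius behaviour and would
  warrant a `refuted-substantive` campaign (it would also answer GHK/ADKS negatively) — results go here.
* **Why it resists (briefing).** When is the crux false?  (i) Jump world with a strict fire-break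
  `p_c(ℤ³ ∖ I_{p_c}) > p_c` — that is the route's own S2, unprovable short of exhibiting the jump; note that in a
  jump world WITHOUT strict fire-break (AG-immune `I_{p_c}`, cf. the planes example) the crux may even hold.
  (ii) Continuity world with 3-D non-recovery: needs cages (¬S0, contra GHK's expectation) or a threshold shift
  bounded below uniformly in `δ` for a deleted set of VANISHING density `θ(p) → 0` — every known strictness
  mechanism (Aizenman–Grimmett, Chayes–Schonmann for iid deletions) gives shifts `O(density)`, none gives a
  uniform one.  What a PROOF needs (for the lead): even granted `θ(p) → 0`, bad boxes "touched by `I_p`" at a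
  fixed scale `L` have vanishing density `≈ (L/ξ(p))^{3-d_f}` but are FKG-correlated up to `ξ(p) → ∞`, so
  Liggett–Schonmann–Stacey domination is unavailable at scale `L`; at scales `≫ ξ(p)` every box is touched and
  one needs the absence of vacant-set-separating sheets inside ONE slightly supercritical cluster (the
  planner's `NoSheetsAtScale`), plus `θ(p) → 0` itself ("consumed core": in a jump world S1 must beat S2).
-/

noncomputable section

namespace Summit.CriticalPhenomena.PercolationContinuityZ3.Cruxes.VacantReignition.Disproof

open MeasureTheory ProbabilityTheory Set Filter Topology
open scoped ENNReal
open Literature.Probability.Percolation Literature.Probability.LatticeModels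
open Summit.CriticalPhenomena.PercolationContinuityZ3.Theses.PercBurnResprinkle

attribute [local instance] isProbabilityMeasure_volume_restrict_unitInterval
  isProbabilityMeasure_labelMeasure

/-! ### Notation: the objects of the crux -/

/-- The vertex type of `ℤ³`. -/
abbrev V3 : Type := Fin 3 → ℤ

/-- A pair of label fields `π = (U, U′)` (environment labels, fresh labels). -/
abbrev Labels2 : Type := (Sym2 V3 → ℝ) × (Sym2 V3 → ℝ)

/-- `p_c(ℤ³)` (bond, at the origin). -/
abbrev pc : ℝ := criticalProb (zdGraph 3) (0 : V3)

/-- The law of the two independent label fields, `labelMeasure ⊗ labelMeasure`. -/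
abbrev μ2 : Measure Labels2 := (labelMeasure V3).prod (labelMeasure V3)

/-- The burnt set `I_p(U) = {y | C_{ω_p}(y) infinite}` of the environment at level `p`. -/
def burnt (p : ℝ) (U : Sym2 V3 → ℝ) : Set V3 :=
  {y | (openCluster (configOfLabels p U (zdGraph 3)) y).Infinite}

/-- The vacant fresh configuration: edges of the fresh field at level `q` with both endpoints
outside the burnt set of the environment at level `p` (verbatim the set-builder of the crux). -/
def vacantFresh (p q : ℝ) (π : Labels2) : BondConfig V3 :=
  {e | e ∈ configOfLabels q π.2 (zdGraph 3) ∧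
    ∀ y ∈ e, ¬ (openCluster (configOfLabels p π.1 (zdGraph 3)) y).Infinite}

/-- The reignition event: the origin lies in an infinite cluster of the vacant fresh configuration. -/
def reignites (p q : ℝ) : Set Labels2 :=
  {π | (openCluster (vacantFresh p q π) (0 : V3)).Infinite}

/-- The crux, restated through `reignites` (definitional). -/
theorem vacantReignition_iff :
    VacantReignition ↔ ∀ ε : ℝ, 0 < ε → ∃ p : ℝ, pc < p ∧ 0 < μ2.real (reignites p (pc + ε)) :=
  Iff.rfl

/-- `labelMeasure ⊗ labelMeasure` is a probability measure (no junk: the `if` in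
`Measure.infinitePi` takes its `then` branch, `isProbabilityMeasure_volume_restrict_unitInterval`). -/
instance instIsProbabilityMeasureμ2 : IsProbabilityMeasure μ2 := by infer_instance

/-- `p_c(ℤ³) ≤ 1`. -/
theorem pc_le_one : pc ≤ 1 := (criticalProb_mem_Icc _ _).2

/-- `0 ≤ p_c(ℤ³)`. -/
theorem pc_nonneg : 0 ≤ pc := (criticalProb_mem_Icc _ _).1

/-! ### Measure-theoretic helpers -/

/-- One-coordinate marginal of the label field: `P(U_e ∈ s) = Leb(s ∩ [0,1])`. -/
theorem labelMeasure_setOf_eval_mem (e : Sym2 V3) {s : Set ℝ} (hs : MeasurableSet s) :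
    labelMeasure V3 {U | U e ∈ s} = volume (s ∩ Icc (0 : ℝ) 1) := by
  rw [show {U : Sym2 V3 → ℝ | U e ∈ s} = (fun U : Sym2 V3 → ℝ => U e) ⁻¹' s from rfl,
    ← Measure.map_apply (measurable_pi_apply e) hs, labelMeasure, Measure.infinitePi_map_eval,
    Measure.restrict_apply hs]

/-- No label is below a negative level: `P(∃ e, U_e ≤ q) = 0` for `q < 0`. -/
theorem labelMeasure_exists_le_eq_zero {q : ℝ} (hq : q < 0) :
    labelMeasure V3 {U | ∃ e, U e ≤ q} = 0 := by
  rw [show {U : Sym2 V3 → ℝ | ∃ e, U e ≤ q} = ⋃ e, {U | U e ∈ Iic q} by ext U; simp]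
  refine measure_iUnion_null fun e => ?_
  rw [labelMeasure_setOf_eval_mem e measurableSet_Iic]
  have : Iic q ∩ Icc (0 : ℝ) 1 = ∅ := by
    ext x; simp only [mem_inter_iff, mem_Iic, mem_Icc, mem_empty_iff_false, iff_false]
    rintro ⟨h1, h2, -⟩; linarith
  rw [this, measure_empty]

/-- No label exceeds `1`: `P(∃ e, 1 < U_e) = 0`. -/
theorem labelMeasure_exists_one_lt_eq_zero :
    labelMeasure V3 {U | ∃ e, 1 < U e} = 0 := by
  rw [show {U : Sym2 V3 → ℝ | ∃ e, 1 < U e} = ⋃ e, {U | U e ∈ Ioi 1} by ext U; simp]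
  refine measure_iUnion_null fun e => ?_
  rw [labelMeasure_setOf_eval_mem e measurableSet_Ioi]
  have : Ioi (1 : ℝ) ∩ Icc (0 : ℝ) 1 = ∅ := by
    ext x; simp only [mem_inter_iff, mem_Ioi, mem_Icc, mem_empty_iff_false, iff_false]
    rintro ⟨h1, -, h2⟩; linarith
  rw [this, measure_empty]

/-- Marginal on the environment labels. -/
theorem μ2_preimage_fst (S : Set (Sym2 V3 → ℝ)) : μ2 (Prod.fst ⁻¹' S) = labelMeasure V3 S := by
  rw [← prod_univ, Measure.prod_prod, measure_univ, mul_one]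

/-- Marginal on the fresh labels. -/
theorem μ2_preimage_snd (S : Set (Sym2 V3 → ℝ)) : μ2 (Prod.snd ⁻¹' S) = labelMeasure V3 S := by
  rw [← univ_prod, Measure.prod_prod, measure_univ, one_mul]

/-- A sub-event of a null event has real measure `0`. -/
theorem real_eq_zero_of_subset_null {E N : Set Labels2} (h : E ⊆ N) (hN : μ2 N = 0) :
    μ2.real E = 0 := by
  simp [measureReal_def, measure_mono_null h hN]

/-! ### Combinatorial helpers -/

/-- The open cluster of the empty configuration is a singleton. -/
theorem openCluster_empty (x : V3) : openCluster (∅ : BondConfig V3) x = {x} := by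
  ext y
  simp only [openCluster, mem_setOf_eq, mem_singleton_iff]
  have hbot : openGraph (∅ : BondConfig V3) = ⊥ := SimpleGraph.fromEdgeSet_empty
  rw [hbot, SimpleGraph.reachable_bot]
  exact eq_comm

/-- An infinite open cluster uses at least one open edge. -/
theorem nonempty_of_infinite_openCluster {ω : BondConfig V3} {x : V3}
    (h : (openCluster ω x).Infinite) : ω.Nonempty := by
  by_contra hne
  rw [not_nonempty_iff_eq_empty] at hne
  rw [hne, openCluster_empty] at h
  exact h (finite_singleton x)

/-- `ℤ³` is infinite. -/
instance instInfiniteV3 : Infinite V3 := Infinite.of_injective (fun n : ℤ => fun _ : Fin 3 => n)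
  (fun a b h => by simpa using congrFun h 0)

/-- If every environment label is `≤ 1` and `p ≥ 1`, the environment is all of `E(ℤ³)`, every
vertex is burnt, and the vacant fresh configuration is empty. -/
theorem vacantFresh_eq_empty_of_labels_le_one {p : ℝ} (hp : 1 ≤ p) (q : ℝ) {π : Labels2}
    (hU : ∀ e, π.1 e ≤ 1) : vacantFresh p q π = ∅ := by
  have hconf : configOfLabels p π.1 (zdGraph 3) = (zdGraph 3).edgeSet := by
    ext e; exact ⟨fun h => h.1, fun he => ⟨he, (hU e).trans hp⟩⟩
  have hburn : ∀ y : V3, (openCluster (configOfLabels p π.1 (zdGraph 3)) y).Infinite := by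
    intro y
    have : openCluster (configOfLabels p π.1 (zdGraph 3)) y = univ := by
      ext z
      simp only [openCluster, hconf, openGraph, SimpleGraph.fromEdgeSet_edgeSet, mem_setOf_eq,
        mem_univ, iff_true]
      exact zdGraph_reachable y z
    rw [this]; exact infinite_univ
  ext e
  simp only [vacantFresh, mem_setOf_eq, mem_empty_iff_false, iff_false, not_and, not_forall,
    not_not]
  intro _
  exact ⟨e.out.1, Sym2.out_fst_mem e, hburn _⟩

/-! ### (b) Structure: monotonicity in the two levels -/

/-- Raising the environment level shrinks the vacant fresh configuration. -/
theorem vacantFresh_anti {p p' : ℝ} (h : p ≤ p') (q : ℝ) (π : Labels2) :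
    vacantFresh p' q π ⊆ vacantFresh p q π := by
  rintro e ⟨he, hvac⟩
  refine ⟨he, fun y hy hinf => hvac y hy ?_⟩
  exact hinf.mono (openCluster_mono (configOfLabels_mono π.1 (zdGraph 3) h) y)

/-- Raising the field level enlarges the vacant fresh configuration. -/
theorem vacantFresh_mono_level {q q' : ℝ} (h : q ≤ q') (p : ℝ) (π : Labels2) :
    vacantFresh p q π ⊆ vacantFresh p q' π := by
  rintro e ⟨he, hvac⟩
  exact ⟨configOfLabels_mono π.2 (zdGraph 3) h he, hvac⟩

/-- The reignition event is antitone in the environment level `p`. -/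
theorem reignites_anti {p p' : ℝ} (h : p ≤ p') (q : ℝ) : reignites p' q ⊆ reignites p q :=
  fun π hπ => hπ.mono (openCluster_mono (vacantFresh_anti h q π) 0)

/-- The reignition event is monotone in the field level `q`. -/
theorem reignites_mono_level {q q' : ℝ} (h : q ≤ q') (p : ℝ) : reignites p q ⊆ reignites p q' :=
  fun π hπ => hπ.mono (openCluster_mono (vacantFresh_mono_level h p π) 0)

/-- `∃ p > p_c` is the same as `for all p close enough to p_c` (monotone coupling, pathwise). -/
theorem vacantReignition_iff_eventually :
    VacantReignition ↔ ∀ ε : ℝ, 0 < ε → ∃ p₀ : ℝ, pc < p₀ ∧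
      ∀ p ∈ Ioc pc p₀, 0 < μ2.real (reignites p (pc + ε)) := by
  rw [vacantReignition_iff]
  refine ⟨fun h ε hε => ?_, fun h ε hε => ?_⟩
  · obtain ⟨p₀, hp₀, hpos⟩ := h ε hε
    refine ⟨p₀, hp₀, fun p hp => hpos.trans_le ?_⟩
    exact measureReal_mono (reignites_anti hp.2 _)
  · obtain ⟨p₀, hp₀, hall⟩ := h ε hε
    exact ⟨p₀, hp₀, hall p₀ ⟨hp₀, le_rfl⟩⟩

/-! ### (a) Load-bearing analysis: the hypothesis `0 < ε` -/

/-- At a negative field level the reignition event is null (no label is negative). -/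
theorem reignites_null_of_level_neg (p : ℝ) {q : ℝ} (hq : q < 0) : μ2 (reignites p q) = 0 := by
  have hsub : reignites p q ⊆ Prod.snd ⁻¹' {U | ∃ e, U e ≤ q} := by
    intro π hπ
    obtain ⟨e, he⟩ := nonempty_of_infinite_openCluster hπ
    simp only [mem_preimage, mem_setOf_eq]
    exact ⟨e, he.1.2⟩
  refine measure_mono_null hsub ?_
  rw [μ2_preimage_snd]
  exact labelMeasure_exists_le_eq_zero hq

/-- The crux with its only hypothesis `0 < ε` dropped. -/
def VacantReignitionWithoutEpsPos : Prop :=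
  ∀ ε : ℝ, ∃ p : ℝ, pc < p ∧ 0 < μ2.real (reignites p (pc + ε))

/-- **Any proof must use `0 < ε`**: at `ε = -2` the field level `p_c - 2` is negative, the fresh
field is almost surely empty and the reignition probability is `0` for every `p`. -/
theorem vacantReignition_false_without_eps_pos : ¬ VacantReignitionWithoutEpsPos := by
  intro h
  obtain ⟨p, -, hpos⟩ := h (-2)
  have hlev : pc + -2 < 0 := by linarith [pc_le_one]
  have : μ2.real (reignites p (pc + -2)) = 0 := by
    simp [measureReal_def, reignites_null_of_level_neg p hlev]
  linarith

/-! ### (b') The witness `p` lives in `(p_c, 1)`: the event is null for `p ≥ 1` -/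

/-- For `p ≥ 1` the burnt set is a.s. all of `ℤ³` and reignition is a null event. -/
theorem reignites_null_of_one_le {p : ℝ} (hp : 1 ≤ p) (q : ℝ) : μ2 (reignites p q) = 0 := by
  have hsub : reignites p q ⊆ Prod.fst ⁻¹' {U | ∃ e, 1 < U e} := by
    intro π hπ
    by_contra hU
    simp only [mem_preimage, mem_setOf_eq, not_exists, not_lt] at hU
    have hempty := vacantFresh_eq_empty_of_labels_le_one hp q hU
    simp only [reignites, mem_setOf_eq, hempty, openCluster_empty] at hπ
    exact hπ (finite_singleton 0)
  refine measure_mono_null hsub ?_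
  rw [μ2_preimage_fst]
  exact labelMeasure_exists_one_lt_eq_zero

/-- The strengthening of the crux with `∃ p > p_c` replaced by `∀ p > p_c`. -/
def VacantReignitionAllP : Prop :=
  ∀ ε : ℝ, 0 < ε → ∀ p : ℝ, pc < p → 0 < μ2.real (reignites p (pc + ε))

/-- **Refuted strengthening**: reignition fails for `p = 2 > p_c` (burnt set = everything). The
honest content of the crux is the regime `p ↓ p_c`; cf. `vacantReignition_iff_eventually`. -/
theorem not_vacantReignitionAllP : ¬ VacantReignitionAllP := by
  intro h
  have h2 : pc < 2 := by linarith [pc_le_one]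
  have hpos := h 1 one_pos 2 h2
  have : μ2.real (reignites 2 (pc + 1)) = 0 := by
    simp [measureReal_def, reignites_null_of_one_le (by norm_num : (1 : ℝ) ≤ 2) (pc + 1)]
  linarith

/-! ### (c) The strengthening `ε = 0` forces a jump -/

/-- The reignition probability at field level `q ∈ [0, 1]` is at most `θ(q)`: the vacant fresh
configuration is a sub-configuration of the full fresh field, whose law is `P_q`
(`map_configOfLabels_holds`). -/
theorem real_reignites_le_theta (p : ℝ) (q : unitInterval) :
    μ2.real (reignites p q) ≤ theta (zdGraph 3) (0 : V3) q := by
  have hsub : reignites p q ⊆ Prod.snd ⁻¹'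
      ((fun U : Sym2 V3 → ℝ => configOfLabels (q : ℝ) U (zdGraph 3)) ⁻¹' percolatesAt 0) := by
    intro π hπ
    exact hπ.mono (openCluster_mono (fun e he => he.1) 0)
  calc μ2.real (reignites p q)
      ≤ μ2.real (Prod.snd ⁻¹'
          ((fun U : Sym2 V3 → ℝ => configOfLabels (q : ℝ) U (zdGraph 3)) ⁻¹' percolatesAt 0)) :=
        measureReal_mono hsub
    _ = (labelMeasure V3 ((fun U : Sym2 V3 → ℝ => configOfLabels (q : ℝ) U (zdGraph 3)) ⁻¹'
          percolatesAt 0)).toReal := by rw [measureReal_def, μ2_preimage_snd]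
    _ = theta (zdGraph 3) (0 : V3) q := by
        rw [theta, measureReal_def, ← map_configOfLabels_holds (zdGraph 3) q,
          Measure.map_apply (measurable_configOfLabels _ _) (measurableSet_percolatesAt_holds 0)]

/-- The strengthening `ε = 0`: reignition with the fresh field exactly at `p_c(ℤ³)`. -/
def VacantReignitionAtCriticalLevel : Prop :=
  ∃ p : ℝ, pc < p ∧ 0 < μ2.real (reignites p pc)

/-- **`ε = 0` forces `θ(p_c) > 0`**: a vacant fresh cluster at level `p_c` is in particular an
infinite cluster of Bernoulli(`p_c`) percolation on `ℤ³`. -/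
theorem jump_of_vacantReignitionAtCriticalLevel (h : VacantReignitionAtCriticalLevel) :
    0 < theta (zdGraph 3) (0 : V3) (criticalProbI 3) := by
  obtain ⟨p, -, hpos⟩ := h
  exact hpos.trans_le (real_reignites_le_theta p (criticalProbI 3))

/-- Hence in the continuity world (`θ(p_c) = 0`, the summit conjunct) the `ε = 0` strengthening is
false: the crux is sharp at `ε = 0` modulo the conjecture itself. -/
theorem not_vacantReignitionAtCriticalLevel_of_continuity (hc : _root_.PercolationContinuityZ3) :
    ¬ VacantReignitionAtCriticalLevel := fun h =>
  (jump_of_vacantReignitionAtCriticalLevel h).ne'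
    ((percolationContinuityZ3_iff.1 hc))

/-! ### Open strengthenings (no verdict) -/

/-- **Quantifier swap (open, expected false, not cheaply decidable).** One environment level `p > p_c`
that reignites at EVERY field level `p_c + ε`: equivalently `p_c(ℤ³ ∖ I_p) = p_c(ℤ³)` together with
reignition arbitrarily close to the threshold.  Aizenman–Grimmett heuristics (deleting the positive-density
stationary set `I_p` is an essential diminishment) predict `p_c(ℤ³ ∖ I_p) > p_c(ℤ³)` for every `p > p_c`,
which would refute this; but AG strictness fails for SOME stationary positive-density deletions (random
parallel planes), so a proof must use the FKG / uniqueness geometry of `I_p` — unwritten (cf. item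
stmt-CriticalPhenomena-7204).  Recorded as a target for later cycles; MC estimates `Δ_vac(δ) > 0` would
support its falsity numerically. -/
def UniformReignition : Prop :=
  ∃ p : ℝ, pc < p ∧ ∀ ε : ℝ, 0 < ε → 0 < μ2.real (reignites p (pc + ε))

/-- `UniformReignition` trivially implies the crux (it IS the quantifier swap). -/
theorem vacantReignition_of_uniformReignition (h : UniformReignition) : VacantReignition := by
  rw [vacantReignition_iff]
  obtain ⟨p, hp, hall⟩ := h
  exact fun ε hε => ⟨p, hp, hall ε hε⟩

/-! ### The `Cages` failure mode made formal (deterministic toy model) -/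

/-- The walls of mesh `n`: vertices with some coordinate divisible by `n` (a union of three
families of parallel lattice planes; density `≤ 3/n`). -/
def walls (n : ℕ) : Set V3 := {x | ∃ i, (n : ℤ) ∣ x i}

/-- Integer division is constant on a step `a ↦ a + 1` that does not land on a multiple of `n`. -/
theorem ediv_add_one_eq {n : ℤ} (hn : 0 < n) {a : ℤ} (h : ¬ n ∣ a + 1) : (a + 1) / n = a / n := by
  have h1 : a / n ≤ (a + 1) / n := Int.ediv_le_ediv hn (by linarith)
  have h2 : (a + 1) / n ≤ a / n + 1 := by
    have : (a + 1) / n ≤ (a + 1 * n) / n := Int.ediv_le_ediv hn (by linarith)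
    rwa [Int.add_mul_ediv_right _ _ hn.ne'] at this
  rcases lt_or_eq_of_le h1 with hlt | heq
  · exfalso
    have hq : (a + 1) / n = a / n + 1 := le_antisymm h2 (by omega)
    have hle : (a / n + 1) * n ≤ a + 1 := by
      rw [← hq]; exact Int.ediv_mul_le _ hn.ne'
    have hlt' : a < (a / n + 1) * n := by
      rw [← Int.ediv_lt_iff_lt_mul hn]; exact lt_add_one _
    exact h ⟨a / n + 1, by linarith [mul_comm (a / n + 1) n]⟩
  · exact heq.symm

/-- The cell index `(⌊x_i / n⌋)_i` is invariant along an edge of `ℤ³` avoiding the walls. -/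
theorem cell_eq_of_adj {n : ℕ} (hn : 0 < n) {u v : V3} (hadj : (zdGraph 3).Adj u v)
    (hu : u ∉ walls n) (hv : v ∉ walls n) (i : Fin 3) : v i / (n : ℤ) = u i / (n : ℤ) := by
  have hn' : (0 : ℤ) < n := by exact_mod_cast hn
  simp only [walls, mem_setOf_eq, not_exists] at hu hv
  obtain ⟨j, h | h⟩ := (zdGraph_adj_iff u v).1 hadj
  · -- v = u + e_j
    subst h
    rcases eq_or_ne i j with rfl | hij
    · simp only [Pi.add_apply, Pi.single_eq_same]
      exact ediv_add_one_eq hn' (by simpa using hv i)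
    · simp [Pi.single_eq_of_ne hij]
  · -- u = v + e_j
    subst h
    rcases eq_or_ne i j with rfl | hij
    · simp only [Pi.add_apply, Pi.single_eq_same]
      exact (ediv_add_one_eq hn' (by simpa using hu i)).symm
    · simp [Pi.single_eq_of_ne hij]

/-- **Cages kill vacant percolation (deterministic toy of the `Cages` failure mode).** If the deleted
set contains the walls of mesh `n` — a periodic set of density `≤ 3/n`, as small as desired — then
every cluster of every configuration on the remaining vertices is finite (it stays in its cell).  So
no argument using only the smallness of the density `θ(p)` of the burnt set can prove
`VacantSetPercolates` / `VacantReignition`: a proof must rule out separating sheets inside the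
slightly supercritical infinite cluster at every scale (the planner's `NoSheetsAtScale`). -/
theorem finite_openCluster_of_walls_deleted {n : ℕ} (hn : 0 < n) {D : Set V3} (hD : walls n ⊆ D)
    {ω : BondConfig V3} (hω : ω ⊆ {e | e ∈ (zdGraph 3).edgeSet ∧ ∀ y ∈ e, y ∉ D}) (x : V3) :
    (openCluster ω x).Finite := by
  -- the cluster stays in the cell of `x`
  have hcell : openCluster ω x ⊆ {y | ∀ i, y i / (n : ℤ) = x i / (n : ℤ)} := by
    intro y hy
    obtain ⟨w⟩ := hy
    suffices key : ∀ {u v : V3} (w : (openGraph ω).Walk u v) (i : Fin 3), v i / (n : ℤ) = u i / (n : ℤ) by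
      exact fun i => key w i
    intro u v w
    induction w with
    | nil => intro i; rfl
    | @cons a b c hab _ ih =>
      intro i
      rw [ih i]
      rw [openGraph_adj] at hab
      obtain ⟨he, hvac⟩ := hω hab.1
      have hadj : (zdGraph 3).Adj a b := by
        simpa [SimpleGraph.mem_edgeSet] using he
      exact cell_eq_of_adj hn hadj (fun h => hvac a (Sym2.mem_mk_left a b) (hD h))
        (fun h => hvac b (Sym2.mem_mk_right a b) (hD h)) i
  -- a cell is finite: it lies in a box
  have hn' : (0 : ℤ) < n := by exact_mod_cast hn
  refine Set.Finite.subset (s := Set.pi univ fun i => Icc (x i / n * n) (x i / n * n + n)) ?_ ?_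
  · exact Set.Finite.pi fun i => finite_Icc _ _
  · intro y hy
    have hy' : ∀ i, y i / (n : ℤ) = x i / (n : ℤ) := hcell hy
    simp only [Set.mem_pi, mem_univ, mem_Icc, forall_true_left]
    intro i
    have hyi : y i / (n : ℤ) = x i / (n : ℤ) := hy' i
    have h1 := Int.ediv_mul_le (y i) hn'.ne'
    have h2 : y i < (y i / n + 1) * n := by
      rw [← Int.ediv_lt_iff_lt_mul hn']; exact lt_add_one _
    rw [hyi] at h1 h2
    constructor <;> nlinarith

/-- **Corollary in crux terms.** On the event that the burnt set `I_p(U)` contains the walls of some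
mesh `n ≥ 1`, reignition fails surely (whatever the fresh labels): `reignites p q ⊆ {¬ walls n ⊆ I_p}`.
A disproof of the crux along these lines would need `I_p ⊇` (a translate/deformation of) such a cage
system with probability one for all `p` near `p_c` — i.e. sheets inside the infinite cluster at every
scale, the 3-D analogue of the planar mechanism; nothing suggests this for `ℤ³`. -/
theorem not_mem_reignites_of_walls_subset_burnt {n : ℕ} (hn : 0 < n) (p q : ℝ) {π : Labels2}
    (h : walls n ⊆ burnt p π.1) : π ∉ reignites p q := by
  intro hπ
  refine hπ (finite_openCluster_of_walls_deleted hn h (fun e he => ?_) 0)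
  exact ⟨he.1.1, he.2⟩

/-! ### Kill chain: `VacantReignition → VacantSetPercolates` (S1 ⇒ S0) -/

/-- The label-free vacant-set event of crux S0 (`VacantSetPercolates`), as a set of configurations. -/
def vacantSetEvent : Set (BondConfig V3) :=
  {ω | (openCluster {e | e ∈ (zdGraph 3).edgeSet ∧ ∀ y ∈ e, ¬ (openCluster ω y).Infinite}
    (0 : V3)).Infinite}

/-- Reignition at environment level `p` implies that the vacant set of `ω_p` percolates from the
origin (drop the fresh-label constraint). -/
theorem reignites_subset_preimage_vacantSetEvent (p q : ℝ) :
    reignites p q ⊆ Prod.fst ⁻¹'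
      ((fun U : Sym2 V3 → ℝ => configOfLabels p U (zdGraph 3)) ⁻¹' vacantSetEvent) := by
  intro π hπ
  refine hπ.mono (openCluster_mono (fun e he => ?_) 0)
  exact ⟨he.1.1, he.2⟩

/-- **S1 ⇒ S0.** `VacantReignition` implies `VacantSetPercolates`: take any `ε > 0` and the
witness `p > p_c`; `p < 1` by `reignites_null_of_one_le`; the environment marginal of the
reignition event is contained in `{ω_p ∈ vacantSetEvent}`, whose probability is at most
`P_p(vacantSetEvent)` (`le_map_apply`, `map_configOfLabels_holds`). -/
theorem vacantSetPercolates_of_vacantReignition (h : VacantReignition) : VacantSetPercolates := by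
  obtain ⟨p, hp, hpos⟩ := (vacantReignition_iff.1 h) 1 one_pos
  have hp1 : p < 1 := by
    by_contra hle
    have := reignites_null_of_one_le (not_lt.1 hle) (pc + 1)
    simp [measureReal_def, this] at hpos
  set p' : unitInterval := ⟨p, pc_nonneg.trans hp.le, hp1.le⟩ with hp'
  refine ⟨p', hp, ?_⟩
  -- positivity of the environment marginal
  have hμ : μ2 (Prod.fst ⁻¹' ((fun U : Sym2 V3 → ℝ => configOfLabels p U (zdGraph 3)) ⁻¹'
      vacantSetEvent)) ≠ 0 := by
    intro h0
    have := real_eq_zero_of_subset_null (reignites_subset_preimage_vacantSetEvent p (pc + 1)) h0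
    linarith
  rw [μ2_preimage_fst] at hμ
  have hle : labelMeasure V3 ((fun U : Sym2 V3 → ℝ => configOfLabels p U (zdGraph 3)) ⁻¹'
      vacantSetEvent) ≤ bondPercolation (zdGraph 3) p' vacantSetEvent := by
    rw [← map_configOfLabels_holds (zdGraph 3) p']
    exact Measure.le_map_apply (measurable_configOfLabels _ _).aemeasurable _
  have hne : bondPercolation (zdGraph 3) p' vacantSetEvent ≠ 0 :=
    fun h0 => hμ (le_antisymm (hle.trans h0.le) bot_le)
  exact (ENNReal.toReal_pos hne (measure_ne_top _ _))

/-- **Kill chain (route docblock, KILL CRITERIA) made formal**: 3-D cages for the slightly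
supercritical infinite cluster (¬ S0) would refute this crux. -/
theorem not_vacantReignition_of_not_vacantSetPercolates (h : ¬ VacantSetPercolates) :
    ¬ VacantReignition := fun h' => h (vacantSetPercolates_of_vacantReignition h')

/-! ### (b'') THE DIAGONAL IS NULL and THE RESAMPLING IDENTITY (proved)

For field level `q ≤ p` the reignition event is NULL (`reignites_null_of_level_le`, and at every root
simultaneously `vacantFresh_noPercolation_of_level_le`), although the fresh field is independent of
the environment; and for ALL `p, q` the two-field (fresh) reignition event has the same probability
as the ONE-field event "the environment's own level-`q` edges off its burnt set `I_p` percolate from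
`x`" (`measure_reignitesAt_eq_same`) — so the crux is LITERALLY the `d = 3`, vertex-deleted, rooted
form of ADKS Thm 2 in the standard monotone coupling (`vacantReignition_iff_sameField`).
Mechanism: the finite-volume exploration of `Λ_N` from its boundary has the strong Markov property in
the elementary form `μ2 (A_M^N) = P (B_M^N)` (`measure_AMN_eq_BMN`: replacing the fresh labels off the
proxy `I^N` by the environment's own labels does not change the probability of the avoiding
connection event — independence of disjointly determined finite-bit events,
`measure_inter_eq_mul_of_detBy`); `I^N ↓ I_p` on every finite window (`compl_Good_subset`,
`tendsto_TB`) transports it to the honest burnt set (`measure_AM_eq_BM`) and continuity from above to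
the percolation events; on the diagonal the one-field event `B_M^N` is squeezed between
`{x ↔ ∂Λ_M}` and `{x ↔ ∂Λ_N}ᶜ` (`BMN_subset`) — equivalently the same-field event is EMPTY
(`sameReignitesAt_eq_empty_of_level_le`).  These are the `ShellIdentity` / `DiagonalVanishes` /
`WeakFireBreak` / `HolesAreFresh`-type facts of the crux ideators' cards (explore-from-infinity,
holes-are-fresh), now theorems for the events the crux needs: any witness `p` of `VacantReignition ε`
lies in the WINDOW `(p_c, p_c + ε)` (`vacantReignition_iff_window`), and the conclusion of the sister
crux `JumpFireBreak` holds with `ε = 0` unconditionally (`jumpFireBreak_conclusion_at_eps_zero`). -/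

/-- Pairs with both members in the box `Λ_N = {-N,…,N}³`. -/
def EBox (N : ℕ) : Set (Sym2 V3) := {e | ∀ v ∈ e, v ∈ box 3 N}

/-- Boundary vertices of `Λ_N`: in the box with some coordinate of modulus `N`. -/
def IsBdry (N : ℕ) (y : V3) : Prop := y ∈ box 3 N ∧ ∃ i, |y i| = N

/-- `x` is joined to the boundary of `Λ_N` by an `ω`-open path inside `Λ_N`. -/
def toBdry (ω : BondConfig V3) (N : ℕ) (x : V3) : Prop :=
  ∃ y, IsBdry N y ∧ (openGraph (ω ∩ EBox N)).Reachable x y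

theorem EBox_mono {M N : ℕ} (h : M ≤ N) : EBox M ⊆ EBox N :=
  fun _ he v hv => box_mono 3 h (he v hv)

theorem toBdry_mono {ω₁ ω₂ : BondConfig V3} (h : ω₁ ⊆ ω₂) {N : ℕ} {x : V3} (hx : toBdry ω₁ N x) :
    toBdry ω₂ N x := by
  obtain ⟨y, hy, hr⟩ := hx
  exact ⟨y, hy, hr.mono (SimpleGraph.fromEdgeSet_mono (inter_subset_inter_left _ h))⟩

theorem toBdry_of_isBdry (ω : BondConfig V3) {N : ℕ} {y : V3} (hy : IsBdry N y) : toBdry ω N y :=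
  ⟨y, hy, SimpleGraph.Reachable.refl _⟩

/-- A lattice step out of the box starts at a boundary vertex. -/
theorem isBdry_of_adj_not_mem {N : ℕ} {x x' : V3} (hadj : (zdGraph 3).Adj x x') (hx : x ∈ box 3 N)
    (hx' : x' ∉ box 3 N) : IsBdry N x := by
  refine ⟨hx, ?_⟩
  rw [mem_box] at hx hx'
  simp only [not_forall, not_and, not_le] at hx'
  obtain ⟨i, hi⟩ := hx'
  refine ⟨i, ?_⟩
  have hxi := hx i
  rw [abs_eq (by positivity)]
  obtain ⟨j, h | h⟩ := (zdGraph_adj_iff x x').1 hadj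
  · subst h
    rcases eq_or_ne i j with rfl | hij
    · simp only [Pi.add_apply, Pi.single_eq_same] at hi
      omega
    · simp only [Pi.add_apply, Pi.single_eq_of_ne hij, add_zero] at hi
      omega
  · subst h
    rcases eq_or_ne i j with rfl | hij
    · simp only [Pi.add_apply, Pi.single_eq_same] at hxi ⊢
      omega
    · simp only [Pi.add_apply, Pi.single_eq_of_ne hij, add_zero] at hxi ⊢
      omega

/-- **First exit.** An `ω`-open walk (`ω` made of lattice edges) from a vertex of `Λ_N` to a
vertex outside `Λ_N` shows that its start is joined to the boundary of `Λ_N` inside `Λ_N`. -/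
theorem toBdry_of_walk {ω : BondConfig V3} (hω : ω ⊆ (zdGraph 3).edgeSet) {N : ℕ} :
    ∀ {x z : V3} (_ : (openGraph ω).Walk x z), x ∈ box 3 N → z ∉ box 3 N → toBdry ω N x
  | _, _, SimpleGraph.Walk.nil, hx, hz => absurd hx hz
  | x, z, SimpleGraph.Walk.cons (v := x') hadj w, hx, hz => by
    by_cases hx' : x' ∈ box 3 N
    · obtain ⟨y, hy, hr⟩ := toBdry_of_walk hω w hx' hz
      refine ⟨y, hy, SimpleGraph.Reachable.trans ?_ hr⟩
      refine SimpleGraph.Adj.reachable ?_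
      rw [openGraph_adj] at hadj ⊢
      refine ⟨⟨hadj.1, ?_⟩, hadj.2⟩
      intro v hv
      rcases Sym2.mem_iff.1 hv with rfl | rfl
      exacts [hx, hx']
    · rw [openGraph_adj] at hadj
      have hG : (zdGraph 3).Adj x x' := by
        have := hω hadj.1
        simpa [SimpleGraph.mem_edgeSet] using this
      exact toBdry_of_isBdry ω (isBdry_of_adj_not_mem hG hx hx')

/-- A boundary vertex of `Λ_N` is outside every smaller box. -/
theorem not_mem_box_of_isBdry {K N : ℕ} (h : K < N) {y : V3} (hy : IsBdry N y) : y ∉ box 3 K := by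
  intro hK
  obtain ⟨-, i, hi⟩ := hy
  rw [mem_box] at hK
  have := hK i
  rw [abs_eq (by positivity)] at hi
  omega

/-- Antitonicity in the box: joined to `∂Λ_N` inside `Λ_N` implies joined to `∂Λ_M` inside `Λ_M`
for `M ≤ N` (lattice configurations). -/
theorem toBdry_anti {ω : BondConfig V3} (hω : ω ⊆ (zdGraph 3).edgeSet) {M N : ℕ} (h : M ≤ N) {x : V3}
    (hx : x ∈ box 3 M) (hN : toBdry ω N x) : toBdry ω M x := by
  rcases h.eq_or_lt with rfl | hlt
  · exact hN
  obtain ⟨y, hy, hr⟩ := hN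
  obtain ⟨w⟩ := hr
  have hω' : ω ∩ EBox N ⊆ (zdGraph 3).edgeSet := fun e he => hω he.1
  have := toBdry_of_walk hω' w hx (not_mem_box_of_isBdry hlt hy)
  exact toBdry_mono inter_subset_left this

/-- Vertices reached inside the box belong to the open cluster. -/
theorem mem_openCluster_of_reachable_inter {ω : BondConfig V3} {N : ℕ} {x y : V3}
    (h : (openGraph (ω ∩ EBox N)).Reachable x y) : y ∈ openCluster ω x :=
  h.mono (SimpleGraph.fromEdgeSet_mono inter_subset_left)

/-- Every finite set of sites lies in some box. -/
theorem exists_subset_box {s : Set V3} (hs : s.Finite) : ∃ K : ℕ, s ⊆ (box 3 K : Set V3) := by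
  classical
  refine ⟨hs.toFinset.sup fun x => Finset.univ.sup fun i => (x i).natAbs, fun x hx => ?_⟩
  rw [Finset.mem_coe, mem_box]
  intro i
  have h1 : (x i).natAbs ≤ Finset.univ.sup fun i => (x i).natAbs :=
    Finset.le_sup (f := fun i => (x i).natAbs) (Finset.mem_univ i)
  have h2 : (Finset.univ.sup fun i => (x i).natAbs) ≤
      hs.toFinset.sup fun x => Finset.univ.sup fun i => (x i).natAbs :=
    Finset.le_sup (f := fun x => Finset.univ.sup fun i => (x i).natAbs) (hs.mem_toFinset.2 hx)
  have := h1.trans h2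
  omega

/-- An infinite open cluster (lattice configuration) reaches the boundary of every box containing
its root. -/
theorem toBdry_of_infinite {ω : BondConfig V3} (hω : ω ⊆ (zdGraph 3).edgeSet) {N : ℕ} {x : V3}
    (hx : x ∈ box 3 N) (hinf : (openCluster ω x).Infinite) : toBdry ω N x := by
  obtain ⟨z, hz, hzN⟩ := hinf.exists_notMem_finset (box 3 N)
  obtain ⟨w⟩ := (hz : (openGraph ω).Reachable x z)
  exact toBdry_of_walk hω w hx hzN

/-- Conversely, reaching the boundary of every large box forces an infinite cluster. -/
theorem infinite_of_toBdry {ω : BondConfig V3} {n₀ : ℕ} {x : V3}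
    (h : ∀ N, n₀ ≤ N → toBdry ω N x) : (openCluster ω x).Infinite := by
  intro hfin
  obtain ⟨K, hK⟩ := exists_subset_box hfin
  obtain ⟨y, hy, hr⟩ := h (max (K + 1) n₀) (le_max_right _ _)
  have hyC : y ∈ openCluster ω x := mem_openCluster_of_reachable_inter hr
  exact not_mem_box_of_isBdry (lt_of_lt_of_le (Nat.lt_succ_self K) (le_max_left _ _)) hy (hK hyC)

/-! #### The finite-volume burnt proxy `I^N` and its locality -/

open Classical in
/-- The finite-volume proxy of the burnt set: vertices of `Λ_N` joined to `∂Λ_N` inside `Λ_N` by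
`p`-open edges of the label field `U`. -/
def INset (p : ℝ) (U : Sym2 V3 → ℝ) (N : ℕ) : Finset V3 :=
  (box 3 N).filter fun y => toBdry (configOfLabels p U (zdGraph 3)) N y

theorem mem_INset {p : ℝ} {U : Sym2 V3 → ℝ} {N : ℕ} {y : V3} :
    y ∈ INset p U N ↔ y ∈ box 3 N ∧ toBdry (configOfLabels p U (zdGraph 3)) N y := by
  classical
  simp [INset, Finset.mem_filter]

theorem configOfLabels_subset_edgeSet (p : ℝ) (U : Sym2 V3 → ℝ) :
    configOfLabels p U (zdGraph 3) ⊆ (zdGraph 3).edgeSet := fun _ he => he.1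

/-- Pairs avoiding the vertex set `S`. -/
def offE (S : Set V3) : Set (Sym2 V3) := {e | ∀ v ∈ e, v ∉ S}

theorem INset_subset_box (p : ℝ) (U : Sym2 V3 → ℝ) (N : ℕ) : INset p U N ⊆ box 3 N := by
  classical
  exact Finset.filter_subset _ _

/-- Boundary vertices are in `I^N` for every field. -/
theorem mem_INset_of_isBdry (p : ℝ) (U : Sym2 V3 → ℝ) {N : ℕ} {b : V3} (hb : IsBdry N b) :
    b ∈ INset p U N :=
  mem_INset.2 ⟨hb.1, toBdry_of_isBdry _ hb⟩

/-- Burnt vertices of the box are in `I^N`. -/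
theorem mem_INset_of_infinite {p : ℝ} {U : Sym2 V3 → ℝ} {N : ℕ} {y : V3} (hy : y ∈ box 3 N)
    (hinf : (openCluster (configOfLabels p U (zdGraph 3)) y).Infinite) : y ∈ INset p U N :=
  mem_INset.2 ⟨hy, toBdry_of_infinite (configOfLabels_subset_edgeSet p U) hy hinf⟩

/-- `toBdry` only looks at edges inside the box. -/
theorem toBdry_congr {ω₁ ω₂ : BondConfig V3} {N : ℕ} (h : ω₁ ∩ EBox N = ω₂ ∩ EBox N) (x : V3) :
    toBdry ω₁ N x ↔ toBdry ω₂ N x := by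
  rw [toBdry, toBdry, h]

/-- Every vertex of an open walk inside `Λ_N` ending on `∂Λ_N` belongs to `I^N`. -/
theorem mem_INset_of_walk {p : ℝ} {U : Sym2 V3 → ℝ} {N : ℕ} :
    ∀ {x b : V3} (w : (openGraph (configOfLabels p U (zdGraph 3) ∩ EBox N)).Walk x b),
      x ∈ box 3 N → IsBdry N b → ∀ v ∈ w.support, v ∈ INset p U N
  | x, _, SimpleGraph.Walk.nil, _, hb => by
    intro v hv
    rw [SimpleGraph.Walk.support_nil, List.mem_singleton] at hv
    subst hv
    exact mem_INset_of_isBdry p U hb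
  | x, b, SimpleGraph.Walk.cons (v := x₁) h w, hx, hb => by
    intro v hv
    rw [SimpleGraph.Walk.support_cons, List.mem_cons] at hv
    rcases hv with rfl | hv
    · exact mem_INset.2 ⟨hx, b, hb, ⟨SimpleGraph.Walk.cons h w⟩⟩
    · have hx₁ : x₁ ∈ box 3 N := ((openGraph_adj _ _ _).1 h).1.2 x₁ (Sym2.mem_mk_right _ _)
      exact mem_INset_of_walk w hx₁ hb v hv

/-- **Locality of `{I^N = S}`.** If two label fields have the same `p`-bits on the pairs inside
`Λ_N` touching `S`, then `I^N(U) = S → I^N(U') = S`. -/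
theorem INset_eq_of_bits {p : ℝ} {N : ℕ} {S : Finset V3} {U U' : Sym2 V3 → ℝ}
    (hbits : ∀ e : Sym2 V3, (∀ v ∈ e, v ∈ box 3 N) → (∃ v ∈ e, v ∈ S) → (U e ≤ p ↔ U' e ≤ p))
    (hU : INset p U N = S) : INset p U' N = S := by
  ext y
  constructor
  · -- a `U'`-walk from `y` to the boundary stays in `S`, walking back from its end
    intro hy
    obtain ⟨-, b, hb, ⟨w⟩⟩ := mem_INset.1 hy
    suffices key : ∀ {u v : V3} (_ : (openGraph (configOfLabels p U' (zdGraph 3) ∩ EBox N)).Walk u v),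
        IsBdry N v → u ∈ S from key w hb
    intro u v w
    induction w with
    | nil =>
      intro hv
      rw [← hU]
      exact mem_INset_of_isBdry p U hv
    | @cons u u₁ v h w₁ ih =>
      intro hv
      have hu₁ : u₁ ∈ S := ih hv
      rw [openGraph_adj] at h
      obtain ⟨⟨⟨he, hle⟩, hbox⟩, hne⟩ := h
      have hbit := hbits s(u, u₁) hbox ⟨u₁, Sym2.mem_mk_right _ _, hu₁⟩
      have hadjU : (openGraph (configOfLabels p U (zdGraph 3) ∩ EBox N)).Adj u u₁ := by
        rw [openGraph_adj]
        exact ⟨⟨⟨he, hbit.2 hle⟩, hbox⟩, hne⟩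
      have hu₁I : u₁ ∈ INset p U N := hU ▸ hu₁
      obtain ⟨-, b₁, hb₁, hr⟩ := mem_INset.1 hu₁I
      rw [← hU]
      exact mem_INset.2 ⟨hbox u (Sym2.mem_mk_left _ _), b₁, hb₁, hadjU.reachable.trans hr⟩
  · -- a `U`-walk from `y ∈ S` to the boundary has all its edges inside `S`, hence is a `U'`-walk
    intro hy
    have hyI : y ∈ INset p U N := hU ▸ hy
    obtain ⟨hybox, b, hb, ⟨w⟩⟩ := mem_INset.1 hyI
    have hsupp := mem_INset_of_walk w hybox hb
    have key : ∀ a c : V3, s(a, c) ∈ w.edges →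
        s(a, c) ∈ (openGraph (configOfLabels p U' (zdGraph 3) ∩ EBox N)).edgeSet := by
      intro a c hac
      have he := w.edges_subset_edgeSet hac
      rw [openGraph, SimpleGraph.edgeSet_fromEdgeSet] at he ⊢
      obtain ⟨⟨⟨heG, hle⟩, hbox⟩, hnd⟩ := he
      have ha : a ∈ S := hU ▸ hsupp a (w.fst_mem_support_of_mem_edges hac)
      have hbit := hbits s(a, c) hbox ⟨a, Sym2.mem_mk_left _ _, ha⟩
      exact ⟨⟨⟨heG, hbit.1 hle⟩, hbox⟩, hnd⟩
    have key' : ∀ e ∈ w.edges, e ∈ (openGraph (configOfLabels p U' (zdGraph 3) ∩ EBox N)).edgeSet := by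
      intro e
      induction e using Sym2.ind with
      | h a c => exact key a c
    exact mem_INset.2 ⟨hybox, b, hb, ⟨w.transfer _ key'⟩⟩

/-- Symmetric form of the locality of `{I^N = S}`. -/
theorem INset_eq_iff_of_bits {p : ℝ} {N : ℕ} {S : Finset V3} {U U' : Sym2 V3 → ℝ}
    (hbits : ∀ e : Sym2 V3, (∀ v ∈ e, v ∈ box 3 N) → (∃ v ∈ e, v ∈ S) → (U e ≤ p ↔ U' e ≤ p)) :
    INset p U N = S ↔ INset p U' N = S :=
  ⟨INset_eq_of_bits hbits, INset_eq_of_bits fun e h1 h2 => (hbits e h1 h2).symm⟩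

/-- Locality of the avoiding-connection event: it only reads the `q`-bits of pairs inside `Λ_M`
avoiding `S`. -/
theorem toBdry_off_congr_of_bits {q : ℝ} {M : ℕ} {S : Set V3} {U U' : Sym2 V3 → ℝ}
    (hbits : ∀ e : Sym2 V3, (∀ v ∈ e, v ∈ box 3 M) → (∀ v ∈ e, v ∉ S) → (U e ≤ q ↔ U' e ≤ q))
    (x : V3) :
    toBdry (configOfLabels q U (zdGraph 3) ∩ offE S) M x ↔ toBdry (configOfLabels q U' (zdGraph 3) ∩ offE S) M x := by
  refine toBdry_congr ?_ x
  ext e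
  constructor
  · rintro ⟨⟨⟨he, hle⟩, hoff⟩, hbox⟩
    exact ⟨⟨⟨he, (hbits e hbox hoff).1 hle⟩, hoff⟩, hbox⟩
  · rintro ⟨⟨⟨he, hle⟩, hoff⟩, hbox⟩
    exact ⟨⟨⟨he, (hbits e hbox hoff).2 hle⟩, hoff⟩, hbox⟩

/-- Locality of `toBdry` for the plain level-`p` configuration. -/
theorem toBdry_config_congr_of_bits {p : ℝ} {N : ℕ} {U U' : Sym2 V3 → ℝ}
    (hbits : ∀ e : Sym2 V3, (∀ v ∈ e, v ∈ box 3 N) → (U e ≤ p ↔ U' e ≤ p)) (x : V3) :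
    toBdry (configOfLabels p U (zdGraph 3)) N x ↔ toBdry (configOfLabels p U' (zdGraph 3)) N x := by
  refine toBdry_congr ?_ x
  ext e
  constructor
  · rintro ⟨⟨he, hle⟩, hbox⟩
    exact ⟨⟨he, (hbits e hbox).1 hle⟩, hbox⟩
  · rintro ⟨⟨he, hle⟩, hbox⟩
    exact ⟨⟨he, (hbits e hbox).2 hle⟩, hbox⟩

/-! #### Finite-bit events: measurability and independence under `labelMeasure` -/

/-- Label fields. -/
abbrev Lab : Type := Sym2 V3 → ℝ

/-- Restriction of a label field to a finite set of pairs. -/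
def restr (T : Finset (Sym2 V3)) (U : Lab) : T → ℝ := fun e => U e

theorem measurable_restr (T : Finset (Sym2 V3)) : Measurable (restr T) :=
  measurable_pi_lambda _ fun e => measurable_pi_apply (e : Sym2 V3)

/-- Threshold bits of a finite family of reals. -/
def bitsOf (T : Finset (Sym2 V3)) (c : ℝ) (v : T → ℝ) : T → Bool := fun e => decide (v e ≤ c)

theorem measurable_bitsOf (T : Finset (Sym2 V3)) (c : ℝ) : Measurable (bitsOf T c) := by
  refine measurable_pi_lambda _ fun e => ?_
  refine measurable_to_bool ?_
  have : (fun v : T → ℝ => bitsOf T c v e) ⁻¹' {true} = {v | v e ≤ c} := by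
    ext v; simp [bitsOf]
  rw [this]
  exact measurableSet_le (measurable_pi_apply e) measurable_const

/-- An event of label fields is determined by the `c`-bits on the finite set of pairs `T`. -/
def DetBy (T : Finset (Sym2 V3)) (c : ℝ) (A : Set Lab) : Prop :=
  ∀ ⦃U U' : Lab⦄, (∀ e ∈ T, (U e ≤ c ↔ U' e ≤ c)) → (U ∈ A ↔ U' ∈ A)

theorem DetBy.eq_preimage {T : Finset (Sym2 V3)} {c : ℝ} {A : Set Lab} (h : DetBy T c A) :
    A = restr T ⁻¹' (bitsOf T c ⁻¹' (bitsOf T c '' (restr T '' A))) := by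
  ext U
  simp only [mem_preimage, mem_image]
  constructor
  · intro hU
    exact ⟨restr T U, ⟨U, hU, rfl⟩, rfl⟩
  · rintro ⟨v, ⟨U', hU', rfl⟩, hv⟩
    refine (h (U := U) (U' := U') fun e he => ?_).2 hU'
    have := congrFun hv ⟨e, he⟩
    simp only [bitsOf, restr, decide_eq_decide] at this
    exact this.symm

theorem DetBy.measurableSet {T : Finset (Sym2 V3)} {c : ℝ} {A : Set Lab} (h : DetBy T c A) :
    MeasurableSet A := by
  rw [h.eq_preimage]
  exact measurable_restr T (measurable_bitsOf T c (Set.toFinite _).measurableSet)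

/-- The coordinates of the label field are independent (i.i.d. uniform). -/
theorem iIndepFun_coord : iIndepFun (fun (e : Sym2 V3) (U : Lab) => U e) (labelMeasure V3) := by
  unfold labelMeasure
  exact iIndepFun_infinitePi (P := fun _ : Sym2 V3 => (volume.restrict (Icc (0 : ℝ) 1)))
    (X := fun _ => id) (fun _ => measurable_id)

theorem indepFun_restr {T F : Finset (Sym2 V3)} (h : Disjoint T F) :
    IndepFun (restr T) (restr F) (labelMeasure V3) :=
  iIndepFun_coord.indepFun_finset T F h (fun e => measurable_pi_apply e)

/-- **Disjointly determined events are independent.** -/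
theorem measure_inter_eq_mul_of_detBy {T F : Finset (Sym2 V3)} (hTF : Disjoint T F) {c c' : ℝ}
    {A B : Set Lab} (hA : DetBy T c A) (hB : DetBy F c' B) :
    labelMeasure V3 (A ∩ B) = labelMeasure V3 A * labelMeasure V3 B := by
  have e1 := hA.eq_preimage
  have e2 := hB.eq_preimage
  rw [e1, e2]
  exact (indepFun_restr hTF).measure_inter_preimage_eq_mul _ _
    (measurable_bitsOf T c (Set.toFinite _).measurableSet)
    (measurable_bitsOf F c' (Set.toFinite _).measurableSet)

/-! The events of the argument and their locality. -/

/-- `{y ↔ ∂Λ_N inside Λ_N at level p}`. -/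
def TB (p : ℝ) (N : ℕ) (y : V3) : Set Lab := {U | toBdry (configOfLabels p U (zdGraph 3)) N y}

/-- `{C_p(y) infinite}`. -/
def Burnt (p : ℝ) (y : V3) : Set Lab := {U | (openCluster (configOfLabels p U (zdGraph 3)) y).Infinite}

/-- `{I^N = S}`. -/
def ES (p : ℝ) (N : ℕ) (S : Finset V3) : Set Lab := {U | INset p U N = S}

open Classical in
/-- Pairs inside `Λ_N` touching `S`. -/
def Tfin (N : ℕ) (S : Finset V3) : Finset (Sym2 V3) :=
  (box 3 N).sym2.filter fun e => ∃ v ∈ e, v ∈ S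

open Classical in
/-- Pairs inside `Λ_M` avoiding `S`. -/
def Ffin (M : ℕ) (S : Finset V3) : Finset (Sym2 V3) :=
  (box 3 M).sym2.filter fun e => ∀ v ∈ e, v ∉ S

theorem disjoint_Tfin_Ffin (N M : ℕ) (S : Finset V3) : Disjoint (Tfin N S) (Ffin M S) := by
  classical
  rw [Finset.disjoint_left]
  intro e hT hF
  simp only [Tfin, Ffin, Finset.mem_filter] at hT hF
  obtain ⟨v, hv, hvS⟩ := hT.2
  exact hF.2 v hv hvS

theorem detBy_ES (p : ℝ) (N : ℕ) (S : Finset V3) : DetBy (Tfin N S) p (ES p N S) := by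
  classical
  intro U U' h
  refine INset_eq_iff_of_bits fun e hbox hS => h e ?_
  simp only [Tfin, Finset.mem_filter, Finset.mem_sym2_iff]
  exact ⟨hbox, hS⟩

theorem detBy_TB (p : ℝ) (N : ℕ) (y : V3) : DetBy ((box 3 N).sym2) p (TB p N y) := by
  intro U U' h
  refine toBdry_config_congr_of_bits (fun e hbox => h e ?_) y
  exact Finset.mem_sym2_iff.2 hbox

theorem measurableSet_TB (p : ℝ) (N : ℕ) (y : V3) : MeasurableSet (TB p N y) :=
  (detBy_TB p N y).measurableSet

theorem measurableSet_ES (p : ℝ) (N : ℕ) (S : Finset V3) : MeasurableSet (ES p N S) :=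
  (detBy_ES p N S).measurableSet

theorem measurableSet_Burnt (p : ℝ) (y : V3) : MeasurableSet (Burnt p y) :=
  (measurableSet_percolatesAt_holds y).preimage (measurable_configOfLabels p (zdGraph 3))

/-! #### The finite-volume identity, the estimates and the limit -/

open scoped ENNReal

/-- The burnt set of the environment. -/
def burntSet (p : ℝ) (U : Lab) : Set V3 := {y | (openCluster (configOfLabels p U (zdGraph 3)) y).Infinite}

/-- The reignition event rooted at `x`. -/
def reignitesAt (p q : ℝ) (x : V3) : Set (Lab × Lab) := {π | (openCluster (vacantFresh p q π) x).Infinite}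

theorem reignites_eq_reignitesAt (p q : ℝ) : reignites p q = reignitesAt p q 0 := rfl

/-- `A_M(x)`: the vacant fresh cluster of `x` reaches `∂Λ_M` inside `Λ_M`. -/
def AM (p q : ℝ) (M : ℕ) (x : V3) : Set (Lab × Lab) :=
  {π | toBdry (configOfLabels q π.2 (zdGraph 3) ∩ offE (burntSet p π.1)) M x}

/-- `A_M^N(x)` (two fields, finite-volume burnt proxy). -/
def AMN (p q : ℝ) (M N : ℕ) (x : V3) : Set (Lab × Lab) :=
  {π | toBdry (configOfLabels q π.2 (zdGraph 3) ∩ offE ↑(INset p π.1 N)) M x}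

/-- `B_M^N(x)` (ONE field, finite-volume burnt proxy). -/
def BMN (p q : ℝ) (M N : ℕ) (x : V3) : Set Lab :=
  {U | toBdry (configOfLabels q U (zdGraph 3) ∩ offE ↑(INset p U N)) M x}

/-- `{x ↔ ∂Λ_M inside Λ_M at level q, off S}`. -/
def CSx (q : ℝ) (M : ℕ) (S : Finset V3) (x : V3) : Set Lab :=
  {U | toBdry (configOfLabels q U (zdGraph 3) ∩ offE ↑S) M x}

theorem detBy_CSx (q : ℝ) (M : ℕ) (S : Finset V3) (x : V3) : DetBy (Ffin M S) q (CSx q M S x) := by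
  classical
  intro U U' h
  refine toBdry_off_congr_of_bits (fun e hbox hS => h e ?_) x
  simp only [Ffin, Finset.mem_filter, Finset.mem_sym2_iff]
  exact ⟨hbox, fun v hv => hS v hv⟩

theorem measurableSet_CSx (q : ℝ) (M : ℕ) (S : Finset V3) (x : V3) : MeasurableSet (CSx q M S x) :=
  (detBy_CSx q M S x).measurableSet

theorem measure_ES_inter_CSx (p q : ℝ) (N M : ℕ) (S : Finset V3) (x : V3) :
    labelMeasure V3 (ES p N S ∩ CSx q M S x) =
      labelMeasure V3 (ES p N S) * labelMeasure V3 (CSx q M S x) :=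
  measure_inter_eq_mul_of_detBy (disjoint_Tfin_Ffin N M S) (detBy_ES p N S) (detBy_CSx q M S x)

/-- The good event: on `Λ_M` the finite-volume proxy `I^N` agrees with the burnt set. -/
def Good (p : ℝ) (M N : ℕ) : Set Lab := {U | ∀ y ∈ box 3 M, (y ∈ INset p U N ↔ y ∈ burntSet p U)}

theorem vacantFresh_eq (p q : ℝ) (π : Lab × Lab) :
    vacantFresh p q π = configOfLabels q π.2 (zdGraph 3) ∩ offE (burntSet p π.1) :=
  Set.ext fun _ => Iff.rfl

theorem reignitesAt_subset_AM (p q : ℝ) {M : ℕ} {x : V3} (hx : x ∈ box 3 M) :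
    reignitesAt p q x ⊆ AM p q M x := by
  intro π hπ
  have hω : vacantFresh p q π ⊆ (zdGraph 3).edgeSet := fun e he => he.1.1
  have := toBdry_of_infinite hω hx hπ
  simpa only [AM, mem_setOf_eq, vacantFresh_eq] using this

theorem AM_subset (p q : ℝ) (M N : ℕ) (x : V3) :
    AM p q M x ⊆ AMN p q M N x ∪ Prod.fst ⁻¹' (Good p M N)ᶜ := by
  intro π hπ
  by_cases hg : π.1 ∈ Good p M N
  · left
    have hset : (configOfLabels q π.2 (zdGraph 3) ∩ offE (burntSet p π.1)) ∩ EBox M =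
        (configOfLabels q π.2 (zdGraph 3) ∩ offE ↑(INset p π.1 N)) ∩ EBox M := by
      ext e
      constructor
      · rintro ⟨⟨hc, hoff⟩, hbox⟩
        refine ⟨⟨hc, fun v hv hvI => hoff v hv ?_⟩, hbox⟩
        exact (hg v (hbox v hv)).1 (Finset.mem_coe.1 hvI)
      · rintro ⟨⟨hc, hoff⟩, hbox⟩
        refine ⟨⟨hc, fun v hv hvB => hoff v hv ?_⟩, hbox⟩
        exact Finset.mem_coe.2 ((hg v (hbox v hv)).2 hvB)
    exact (toBdry_congr hset x).1 hπ
  · right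
    exact hg

theorem compl_Good_subset (p : ℝ) {M N : ℕ} (hMN : M ≤ N) :
    (Good p M N)ᶜ ⊆ ⋃ y ∈ box 3 M, (TB p N y \ Burnt p y) := by
  intro U hU
  simp only [Good, mem_compl_iff, mem_setOf_eq, not_forall] at hU
  obtain ⟨y, hy, hiff⟩ := hU
  have hb : y ∉ burntSet p U := by
    intro hb
    exact hiff ⟨fun _ => hb, fun _ => mem_INset_of_infinite (box_mono 3 hMN hy) hb⟩
  have hI : y ∈ INset p U N := by
    by_contra hI
    exact hiff (iff_of_false hI hb)
  exact mem_iUnion₂.2 ⟨y, hy, (mem_INset.1 hI).2, hb⟩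

/-- `B_M^N(x) ⊆ {x ↔ ∂Λ_M} ∖ {x ↔ ∂Λ_N}` when `x` is strictly inside `Λ_M` and `q ≤ p`. -/
theorem BMN_subset {p q : ℝ} (hqp : q ≤ p) {M₀ M : ℕ} (hM : M₀ < M) (N : ℕ) {x : V3}
    (hx : x ∈ box 3 M₀) : BMN p q M N x ⊆ TB p M x \ TB p N x := by
  intro U hU
  obtain ⟨b, hb, hr⟩ := hU
  have hsub : configOfLabels q U (zdGraph 3) ∩ offE ↑(INset p U N) ⊆ configOfLabels p U (zdGraph 3) :=
    fun e he => configOfLabels_mono U (zdGraph 3) hqp he.1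
  refine ⟨⟨b, hb, hr.mono (SimpleGraph.fromEdgeSet_mono (inter_subset_inter_left _ hsub))⟩, ?_⟩
  intro hN
  have hxN : x ∈ box 3 N := by
    obtain ⟨b', hb', ⟨w''⟩⟩ := id hN
    cases w'' with
    | nil => exact hb'.1
    | cons h'' _ =>
      rw [openGraph_adj] at h''
      exact h''.1.2 x (Sym2.mem_mk_left _ _)
  obtain ⟨w⟩ := hr
  cases w with
  | nil => exact not_mem_box_of_isBdry hM hb hx
  | cons h w' =>
    rw [openGraph_adj] at h
    exact h.1.1.2 x (Sym2.mem_mk_left _ _) (Finset.mem_coe.2 (mem_INset.2 ⟨hxN, hN⟩))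

theorem TB_anti (p : ℝ) {M N : ℕ} (hMN : M ≤ N) {y : V3} (hy : y ∈ box 3 M) : TB p N y ⊆ TB p M y :=
  fun U hU => toBdry_anti (configOfLabels_subset_edgeSet p U) hMN hy hU

theorem Burnt_subset_TB (p : ℝ) {N : ℕ} {y : V3} (hy : y ∈ box 3 N) : Burnt p y ⊆ TB p N y :=
  fun U hU => toBdry_of_infinite (configOfLabels_subset_edgeSet p U) hy hU

/-! The finite-volume identity `μ2 (A_M^N) = P (B_M^N)`. -/

theorem INset_mem_powerset (p : ℝ) (U : Lab) (N : ℕ) : INset p U N ∈ (box 3 N).powerset :=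
  Finset.mem_powerset.2 (INset_subset_box p U N)

theorem mem_BMN_iff (p q : ℝ) (M N : ℕ) (x : V3) (U : Lab) :
    U ∈ BMN p q M N x ↔ ∃ S ∈ (box 3 N).powerset, U ∈ ES p N S ∧ U ∈ CSx q M S x := by
  constructor
  · intro hU
    -- avoid the kernel comparing the SETS `BMN …` and `CSx … (I^N U)`: go through `toBdry`
    have hU' : toBdry (configOfLabels q U (zdGraph 3) ∩ offE ↑(INset p U N)) M x := hU
    have hC : U ∈ CSx q M (INset p U N) x := hU'
    exact ⟨INset p U N, INset_mem_powerset p U N, rfl, hC⟩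
  · rintro ⟨S, -, hS, hC⟩
    have hS' : INset p U N = S := hS
    subst hS'
    have hC' : toBdry (configOfLabels q U (zdGraph 3) ∩ offE ↑(INset p U N)) M x := hC
    exact hC'

theorem BMN_eq_biUnion (p q : ℝ) (M N : ℕ) (x : V3) :
    BMN p q M N x = ⋃ S ∈ (box 3 N).powerset, (ES p N S ∩ CSx q M S x) := by
  ext U
  rw [mem_BMN_iff]
  simp only [mem_iUnion, mem_inter_iff, exists_prop]

theorem mem_AMN_iff (p q : ℝ) (M N : ℕ) (x : V3) (π : Lab × Lab) :
    π ∈ AMN p q M N x ↔ ∃ S ∈ (box 3 N).powerset, π.1 ∈ ES p N S ∧ π.2 ∈ CSx q M S x := by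
  constructor
  · intro hπ
    have hπ' : toBdry (configOfLabels q π.2 (zdGraph 3) ∩ offE ↑(INset p π.1 N)) M x := hπ
    have hC : π.2 ∈ CSx q M (INset p π.1 N) x := hπ'
    exact ⟨INset p π.1 N, INset_mem_powerset p π.1 N, rfl, hC⟩
  · rintro ⟨S, -, hS, hC⟩
    have hS' : INset p π.1 N = S := hS
    subst hS'
    have hC' : toBdry (configOfLabels q π.2 (zdGraph 3) ∩ offE ↑(INset p π.1 N)) M x := hC
    exact hC'

theorem AMN_eq_biUnion (p q : ℝ) (M N : ℕ) (x : V3) :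
    AMN p q M N x = ⋃ S ∈ (box 3 N).powerset, (ES p N S ×ˢ CSx q M S x) := by
  ext π
  rw [mem_AMN_iff]
  simp only [mem_iUnion, mem_prod, exists_prop]

theorem pairwiseDisjoint_ES_inter (p q : ℝ) (M N : ℕ) (x : V3) (s : Set (Finset V3)) :
    s.PairwiseDisjoint fun S => ES p N S ∩ CSx q M S x := by
  intro S _ S' _ hne
  refine Set.disjoint_left.2 fun U hU hU' => hne ?_
  exact (hU.1 : INset p U N = S).symm.trans hU'.1

theorem pairwiseDisjoint_ES_prod (p q : ℝ) (M N : ℕ) (x : V3) (s : Set (Finset V3)) :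
    s.PairwiseDisjoint fun S => ES p N S ×ˢ CSx q M S x := by
  intro S _ S' _ hne
  refine Set.disjoint_left.2 fun π hπ hπ' => hne ?_
  exact ((mem_prod.1 hπ).1 : INset p π.1 N = S).symm.trans (mem_prod.1 hπ').1

theorem measure_BMN (p q : ℝ) (M N : ℕ) (x : V3) :
    labelMeasure V3 (BMN p q M N x) =
      ∑ S ∈ (box 3 N).powerset, labelMeasure V3 (ES p N S) * labelMeasure V3 (CSx q M S x) := by
  rw [BMN_eq_biUnion, measure_biUnion_finset (pairwiseDisjoint_ES_inter p q M N x _)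
    (fun S _ => (measurableSet_ES p N S).inter (measurableSet_CSx q M S x))]
  exact Finset.sum_congr rfl fun S _ => measure_ES_inter_CSx p q N M S x

theorem measure_AMN (p q : ℝ) (M N : ℕ) (x : V3) :
    μ2 (AMN p q M N x) =
      ∑ S ∈ (box 3 N).powerset, labelMeasure V3 (ES p N S) * labelMeasure V3 (CSx q M S x) := by
  rw [AMN_eq_biUnion, measure_biUnion_finset (pairwiseDisjoint_ES_prod p q M N x _)
    (fun S _ => (measurableSet_ES p N S).prod (measurableSet_CSx q M S x))]
  exact Finset.sum_congr rfl fun S _ => Measure.prod_prod _ _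

/-- **The finite-volume resampling identity** (strong Markov property of the exploration of
`Λ_N` from its boundary, in elementary form): replacing the fresh field by the environment's own
labels off `I^N` does not change the probability of the avoiding connection event. -/
theorem measure_AMN_eq_BMN (p q : ℝ) (M N : ℕ) (x : V3) :
    μ2 (AMN p q M N x) = labelMeasure V3 (BMN p q M N x) := by
  rw [measure_AMN, measure_BMN]

/-! The estimate and the limit. -/

theorem measure_reignitesAt_le {p q : ℝ} (hqp : q ≤ p) {x : V3} {M₀ M N : ℕ} (hx : x ∈ box 3 M₀)
    (hM : M₀ < M) (hMN : M ≤ N) :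
    μ2 (reignitesAt p q x) ≤
      (labelMeasure V3 (TB p M x) - labelMeasure V3 (TB p N x)) +
        ∑ y ∈ box 3 M, (labelMeasure V3 (TB p N y) - labelMeasure V3 (Burnt p y)) := by
  have hxM : x ∈ box 3 M := box_mono 3 hM.le hx
  calc μ2 (reignitesAt p q x)
      ≤ μ2 (AM p q M x) := measure_mono (reignitesAt_subset_AM p q hxM)
    _ ≤ μ2 (AMN p q M N x ∪ Prod.fst ⁻¹' (Good p M N)ᶜ) := measure_mono (AM_subset p q M N x)
    _ ≤ μ2 (AMN p q M N x) + μ2 (Prod.fst ⁻¹' (Good p M N)ᶜ) := measure_union_le _ _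
    _ = labelMeasure V3 (BMN p q M N x) + labelMeasure V3 (Good p M N)ᶜ := by
        rw [measure_AMN_eq_BMN, μ2_preimage_fst]
    _ ≤ labelMeasure V3 (TB p M x \ TB p N x) +
          labelMeasure V3 (⋃ y ∈ box 3 M, (TB p N y \ Burnt p y)) :=
        add_le_add (measure_mono (BMN_subset hqp hM N hx)) (measure_mono (compl_Good_subset p hMN))
    _ ≤ (labelMeasure V3 (TB p M x) - labelMeasure V3 (TB p N x)) +
          ∑ y ∈ box 3 M, labelMeasure V3 (TB p N y \ Burnt p y) := by
        refine add_le_add (le_of_eq ?_) (measure_biUnion_finset_le _ _)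
        exact measure_sdiff (TB_anti p hMN hxM)
          (measurableSet_TB p N x).nullMeasurableSet (measure_ne_top _ _)
    _ = (labelMeasure V3 (TB p M x) - labelMeasure V3 (TB p N x)) +
          ∑ y ∈ box 3 M, (labelMeasure V3 (TB p N y) - labelMeasure V3 (Burnt p y)) := by
        congr 1
        refine Finset.sum_congr rfl fun y hy => ?_
        exact measure_sdiff (Burnt_subset_TB p (box_mono 3 hMN hy))
          (measurableSet_Burnt p y).nullMeasurableSet (measure_ne_top _ _)

/-- Continuity from above: `P(y ↔ ∂Λ_N in Λ_N) → P(C(y) infinite)`. -/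
theorem tendsto_TB (p : ℝ) (y : V3) :
    Tendsto (fun N => labelMeasure V3 (TB p N y)) atTop (𝓝 (labelMeasure V3 (Burnt p y))) := by
  obtain ⟨n, hn⟩ := exists_subset_box (Set.finite_singleton y)
  have hy : y ∈ box 3 n := by simpa using hn (mem_singleton y)
  set s : ℕ → Set Lab := fun k => TB p (k + n) y with hs
  have hanti : Antitone s := by
    intro a b hab U hU
    exact toBdry_anti (configOfLabels_subset_edgeSet p U) (by omega) (box_mono 3 (by omega) hy) hU
  have hinter : ⋂ k, s k = Burnt p y := by
    ext U
    simp only [mem_iInter]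
    constructor
    · intro h
      refine infinite_of_toBdry (n₀ := n) fun N hN => ?_
      have := h (N - n)
      simp only [hs, TB, mem_setOf_eq] at this
      rwa [Nat.sub_add_cancel hN] at this
    · intro hU k
      exact toBdry_of_infinite (configOfLabels_subset_edgeSet p U) (box_mono 3 (by omega) hy) hU
  have hlim := tendsto_measure_iInter_atTop (μ := labelMeasure V3)
    (fun k => (measurableSet_TB p (k + n) y).nullMeasurableSet) hanti ⟨0, measure_ne_top _ _⟩
  rw [hinter] at hlim
  exact (tendsto_add_atTop_iff_nat n).1 hlim

/-- **The diagonal / weak fire-break (finite-volume exploration + limit), at an arbitrary root.**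
For field level `q ≤ p` a fresh Bernoulli(`q`) field never percolates from `x` off the burnt set
`I_p` of the environment: `μ2 (reignitesAt p q x) = 0`.  Equivalently `p_c(ℤ³ ∖ I_p) ≥ p` a.s. -/
theorem reignitesAt_null_of_level_le {p q : ℝ} (hqp : q ≤ p) (x : V3) :
    μ2 (reignitesAt p q x) = 0 := by
  obtain ⟨M₀, hM₀⟩ := exists_subset_box (Set.finite_singleton x)
  have hx : x ∈ box 3 M₀ := by simpa using hM₀ (mem_singleton x)
  have step : ∀ M, M₀ < M →
      μ2 (reignitesAt p q x) ≤ labelMeasure V3 (TB p M x) - labelMeasure V3 (Burnt p x) := by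
    intro M hM
    have h1 : Tendsto (fun N => labelMeasure V3 (TB p M x) - labelMeasure V3 (TB p N x)) atTop
        (𝓝 (labelMeasure V3 (TB p M x) - labelMeasure V3 (Burnt p x))) :=
      ENNReal.Tendsto.sub tendsto_const_nhds (tendsto_TB p x) (Or.inl (measure_ne_top _ _))
    have h2 : Tendsto (fun N => ∑ y ∈ box 3 M,
        (labelMeasure V3 (TB p N y) - labelMeasure V3 (Burnt p y))) atTop
        (𝓝 (∑ y ∈ box 3 M, (labelMeasure V3 (Burnt p y) - labelMeasure V3 (Burnt p y)))) :=
      tendsto_finsetSum _ fun y _ =>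
        ENNReal.Tendsto.sub (tendsto_TB p y) tendsto_const_nhds (Or.inl (measure_ne_top _ _))
    have hle := ge_of_tendsto (h1.add h2) (b := μ2 (reignitesAt p q x)) (by
      filter_upwards [eventually_ge_atTop M] with N hN
      exact measure_reignitesAt_le hqp hx hM hN)
    simpa [tsub_self] using hle
  have hlim : Tendsto (fun M => labelMeasure V3 (TB p M x) - labelMeasure V3 (Burnt p x)) atTop
      (𝓝 (labelMeasure V3 (Burnt p x) - labelMeasure V3 (Burnt p x))) :=
    ENNReal.Tendsto.sub (tendsto_TB p x) tendsto_const_nhds (Or.inl (measure_ne_top _ _))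
  rw [tsub_self] at hlim
  have : μ2 (reignitesAt p q x) ≤ 0 :=
    ge_of_tendsto hlim (by
      filter_upwards [eventually_gt_atTop M₀] with M hM
      exact step M hM)
  exact le_antisymm this bot_le

/-- **The diagonal is null at the origin**: for `q ≤ p`, `μ2 (reignites p q) = 0`; any witness `p`
of `VacantReignition ε` lies in `(p_c, p_c + ε)`. -/
theorem reignites_null_of_level_le {p q : ℝ} (hqp : q ≤ p) : μ2 (reignites p q) = 0 :=
  reignitesAt_null_of_level_le hqp 0

/-- **Simultaneously at every root**: for `q ≤ p`, a.s. NO vertex percolates in the vacant fresh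
configuration (countable union). In particular the conclusion of `JumpFireBreak` holds with
`ε = 0` unconditionally — its whole content is the strict increment `ε > 0`. -/
theorem vacantFresh_noPercolation_of_level_le {p q : ℝ} (hqp : q ≤ p) :
    μ2 {π | ∃ x : V3, (openCluster (vacantFresh p q π) x).Infinite} = 0 := by
  have : {π : Lab × Lab | ∃ x : V3, (openCluster (vacantFresh p q π) x).Infinite} =
      ⋃ x : V3, reignitesAt p q x := by
    ext π; simp [reignitesAt]
  rw [this]
  exact measure_iUnion_null fun x => reignitesAt_null_of_level_le hqp x

/-! #### The resampling identity for the reignition event (fresh field = same field) -/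

/-- The SAME-field vacant configuration: the environment's own level-`q` edges off its burnt set. -/
def sameVacant (p q : ℝ) (U : Lab) : BondConfig V3 := configOfLabels q U (zdGraph 3) ∩ offE (burntSet p U)

/-- `B_M(x)`: same-field avoiding connection to `∂Λ_M`. -/
def BM (p q : ℝ) (M : ℕ) (x : V3) : Set Lab := {U | toBdry (sameVacant p q U) M x}

/-- Same-field reignition from `x` (the ADKS / van den Berg–Brouwer form). -/
def sameReignitesAt (p q : ℝ) (x : V3) : Set Lab := {U | (openCluster (sameVacant p q U) x).Infinite}

/-- The burnt pattern on `Λ_M`. -/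
def burntPat (p : ℝ) (M : ℕ) (S : Finset V3) : Set Lab :=
  {U | ∀ y ∈ box 3 M, (y ∈ burntSet p U ↔ y ∈ S)}

theorem measurableSet_burntPat (p : ℝ) (M : ℕ) (S : Finset V3) :
    MeasurableSet (burntPat p M S) := by
  have : burntPat p M S = ⋂ y ∈ box 3 M, {U : Lab | y ∈ burntSet p U ↔ y ∈ S} := by
    ext U; simp [burntPat]
  rw [this]
  refine MeasurableSet.biInter (Set.to_countable _) fun y _ => ?_
  by_cases hy : y ∈ S
  · have : {U : Lab | y ∈ burntSet p U ↔ y ∈ S} = Burnt p y := by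
      ext U; simp [hy, Burnt, burntSet]
    rw [this]; exact measurableSet_Burnt p y
  · have : {U : Lab | y ∈ burntSet p U ↔ y ∈ S} = (Burnt p y)ᶜ := by
      ext U; simp [hy, Burnt, burntSet]
    rw [this]; exact (measurableSet_Burnt p y).compl

/-- On a burnt pattern, the vacant configurations inside `Λ_M` agree. -/
theorem inter_EBox_eq_of_burntPat {p q : ℝ} {M : ℕ} {S : Finset V3} {U : Lab} (hU : U ∈ burntPat p M S)
    (W : Lab) :
    (configOfLabels q W (zdGraph 3) ∩ offE (burntSet p U)) ∩ EBox M =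
      (configOfLabels q W (zdGraph 3) ∩ offE ↑S) ∩ EBox M := by
  ext e
  constructor
  · rintro ⟨⟨hc, hoff⟩, hbox⟩
    refine ⟨⟨hc, fun v hv hvS => hoff v hv ?_⟩, hbox⟩
    exact (hU v (hbox v hv)).2 (Finset.mem_coe.1 hvS)
  · rintro ⟨⟨hc, hoff⟩, hbox⟩
    refine ⟨⟨hc, fun v hv hvB => hoff v hv ?_⟩, hbox⟩
    exact Finset.mem_coe.2 ((hU v (hbox v hv)).1 hvB)

open Classical in
/-- The burnt pattern of a field on `Λ_M`, as a finset. -/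
def burntFin (p : ℝ) (M : ℕ) (U : Lab) : Finset V3 := (box 3 M).filter fun y => y ∈ burntSet p U

theorem mem_burntPat_burntFin (p : ℝ) (M : ℕ) (U : Lab) : U ∈ burntPat p M (burntFin p M U) := by
  classical
  intro y hy
  simp [burntFin, Finset.mem_filter, hy]

theorem burntFin_mem_powerset (p : ℝ) (M : ℕ) (U : Lab) : burntFin p M U ∈ (box 3 M).powerset := by
  classical
  exact Finset.mem_powerset.2 (Finset.filter_subset _ _)

theorem mem_AM_iff (p q : ℝ) (M : ℕ) (x : V3) (π : Lab × Lab) :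
    π ∈ AM p q M x ↔ ∃ S ∈ (box 3 M).powerset, π.1 ∈ burntPat p M S ∧ π.2 ∈ CSx q M S x := by
  constructor
  · intro hπ
    have hπ' : toBdry (configOfLabels q π.2 (zdGraph 3) ∩ offE (burntSet p π.1)) M x := hπ
    refine ⟨burntFin p M π.1, burntFin_mem_powerset p M π.1, mem_burntPat_burntFin p M π.1, ?_⟩
    have hC : toBdry (configOfLabels q π.2 (zdGraph 3) ∩ offE ↑(burntFin p M π.1)) M x :=
      (toBdry_congr (inter_EBox_eq_of_burntPat (mem_burntPat_burntFin p M π.1) π.2) x).1 hπ'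
    exact hC
  · rintro ⟨S, -, hS, hC⟩
    have hC' : toBdry (configOfLabels q π.2 (zdGraph 3) ∩ offE ↑S) M x := hC
    have : toBdry (configOfLabels q π.2 (zdGraph 3) ∩ offE (burntSet p π.1)) M x :=
      (toBdry_congr (inter_EBox_eq_of_burntPat hS π.2) x).2 hC'
    exact this

theorem mem_BM_iff (p q : ℝ) (M : ℕ) (x : V3) (U : Lab) :
    U ∈ BM p q M x ↔ ∃ S ∈ (box 3 M).powerset, U ∈ burntPat p M S ∧ U ∈ CSx q M S x := by
  constructor
  · intro hU
    have hU' : toBdry (configOfLabels q U (zdGraph 3) ∩ offE (burntSet p U)) M x := hU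
    refine ⟨burntFin p M U, burntFin_mem_powerset p M U, mem_burntPat_burntFin p M U, ?_⟩
    have hC : toBdry (configOfLabels q U (zdGraph 3) ∩ offE ↑(burntFin p M U)) M x :=
      (toBdry_congr (inter_EBox_eq_of_burntPat (mem_burntPat_burntFin p M U) U) x).1 hU'
    exact hC
  · rintro ⟨S, -, hS, hC⟩
    have hC' : toBdry (configOfLabels q U (zdGraph 3) ∩ offE ↑S) M x := hC
    have : toBdry (configOfLabels q U (zdGraph 3) ∩ offE (burntSet p U)) M x :=
      (toBdry_congr (inter_EBox_eq_of_burntPat hS U) x).2 hC'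
    exact this

theorem measurableSet_AM (p q : ℝ) (M : ℕ) (x : V3) : MeasurableSet (AM p q M x) := by
  have : AM p q M x = ⋃ S ∈ (box 3 M).powerset, (burntPat p M S ×ˢ CSx q M S x) := by
    ext π; rw [mem_AM_iff]; simp only [mem_iUnion, mem_prod, exists_prop]
  rw [this]
  exact MeasurableSet.biUnion (Set.to_countable _) fun S _ =>
    (measurableSet_burntPat p M S).prod (measurableSet_CSx q M S x)

theorem measurableSet_BM (p q : ℝ) (M : ℕ) (x : V3) : MeasurableSet (BM p q M x) := by
  have : BM p q M x = ⋃ S ∈ (box 3 M).powerset, (burntPat p M S ∩ CSx q M S x) := by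
    ext U; rw [mem_BM_iff]; simp only [mem_iUnion, mem_inter_iff, exists_prop]
  rw [this]
  exact MeasurableSet.biUnion (Set.to_countable _) fun S _ =>
    (measurableSet_burntPat p M S).inter (measurableSet_CSx q M S x)

/-- On the good event the proxy events agree with the honest ones (two fields). -/
theorem AM_iff_AMN_of_good {p q : ℝ} {M N : ℕ} {x : V3} {π : Lab × Lab} (hg : π.1 ∈ Good p M N) :
    π ∈ AM p q M x ↔ π ∈ AMN p q M N x := by
  have hset : (configOfLabels q π.2 (zdGraph 3) ∩ offE (burntSet p π.1)) ∩ EBox M =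
      (configOfLabels q π.2 (zdGraph 3) ∩ offE ↑(INset p π.1 N)) ∩ EBox M := by
    ext e
    constructor
    · rintro ⟨⟨hc, hoff⟩, hbox⟩
      refine ⟨⟨hc, fun v hv hvI => hoff v hv ?_⟩, hbox⟩
      exact (hg v (hbox v hv)).1 (Finset.mem_coe.1 hvI)
    · rintro ⟨⟨hc, hoff⟩, hbox⟩
      refine ⟨⟨hc, fun v hv hvB => hoff v hv ?_⟩, hbox⟩
      exact Finset.mem_coe.2 ((hg v (hbox v hv)).2 hvB)
  have h1 : π ∈ AM p q M x ↔ toBdry (configOfLabels q π.2 (zdGraph 3) ∩ offE (burntSet p π.1)) M x := Iff.rfl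
  have h2 : π ∈ AMN p q M N x ↔ toBdry (configOfLabels q π.2 (zdGraph 3) ∩ offE ↑(INset p π.1 N)) M x :=
    Iff.rfl
  rw [h1, h2]
  exact toBdry_congr hset x

/-- On the good event the proxy events agree with the honest ones (one field). -/
theorem BM_iff_BMN_of_good {p q : ℝ} {M N : ℕ} {x : V3} {U : Lab} (hg : U ∈ Good p M N) :
    U ∈ BM p q M x ↔ U ∈ BMN p q M N x := by
  have hset : (configOfLabels q U (zdGraph 3) ∩ offE (burntSet p U)) ∩ EBox M =
      (configOfLabels q U (zdGraph 3) ∩ offE ↑(INset p U N)) ∩ EBox M := by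
    ext e
    constructor
    · rintro ⟨⟨hc, hoff⟩, hbox⟩
      refine ⟨⟨hc, fun v hv hvI => hoff v hv ?_⟩, hbox⟩
      exact (hg v (hbox v hv)).1 (Finset.mem_coe.1 hvI)
    · rintro ⟨⟨hc, hoff⟩, hbox⟩
      refine ⟨⟨hc, fun v hv hvB => hoff v hv ?_⟩, hbox⟩
      exact Finset.mem_coe.2 ((hg v (hbox v hv)).2 hvB)
  have h1 : U ∈ BM p q M x ↔ toBdry (configOfLabels q U (zdGraph 3) ∩ offE (burntSet p U)) M x := Iff.rfl
  have h2 : U ∈ BMN p q M N x ↔ toBdry (configOfLabels q U (zdGraph 3) ∩ offE ↑(INset p U N)) M x := Iff.rfl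
  rw [h1, h2]
  exact toBdry_congr hset x

/-- The bad-event bound `g N = Σ_{y ∈ Λ_M} (P(y ↔ ∂Λ_N) − P(C(y) = ∞)) → 0`. -/
theorem tendsto_badBound (p : ℝ) (M : ℕ) :
    Tendsto (fun N => ∑ y ∈ box 3 M, (labelMeasure V3 (TB p N y) - labelMeasure V3 (Burnt p y)))
      atTop (𝓝 0) := by
  have : (0 : ℝ≥0∞) = ∑ y ∈ box 3 M, (labelMeasure V3 (Burnt p y) - labelMeasure V3 (Burnt p y)) := by
    simp
  rw [this]
  exact tendsto_finsetSum _ fun y _ =>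
    ENNReal.Tendsto.sub (tendsto_TB p y) tendsto_const_nhds (Or.inl (measure_ne_top _ _))

theorem measure_compl_Good_le (p : ℝ) {M N : ℕ} (hMN : M ≤ N) :
    labelMeasure V3 (Good p M N)ᶜ ≤
      ∑ y ∈ box 3 M, (labelMeasure V3 (TB p N y) - labelMeasure V3 (Burnt p y)) := by
  calc labelMeasure V3 (Good p M N)ᶜ
      ≤ labelMeasure V3 (⋃ y ∈ box 3 M, (TB p N y \ Burnt p y)) := measure_mono (compl_Good_subset p hMN)
    _ ≤ ∑ y ∈ box 3 M, labelMeasure V3 (TB p N y \ Burnt p y) := measure_biUnion_finset_le _ _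
    _ = ∑ y ∈ box 3 M, (labelMeasure V3 (TB p N y) - labelMeasure V3 (Burnt p y)) := by
        refine Finset.sum_congr rfl fun y hy => ?_
        exact measure_sdiff (Burnt_subset_TB p (box_mono 3 hMN hy))
          (measurableSet_Burnt p y).nullMeasurableSet (measure_ne_top _ _)

/-- A constant squeezed against a sequence up to a vanishing error is its limit. -/
theorem tendsto_of_abs_le {a : ℕ → ℝ≥0∞} {c : ℝ≥0∞} {g : ℕ → ℝ≥0∞} (hc : c ≠ ∞)
    (hg : Tendsto g atTop (𝓝 0)) (h1 : ∀ᶠ N in atTop, c ≤ a N + g N) (h2 : ∀ᶠ N in atTop, a N ≤ c + g N) :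
    Tendsto a atTop (𝓝 c) := by
  have hlow : Tendsto (fun N => c - g N) atTop (𝓝 c) := by
    have := ENNReal.Tendsto.sub (tendsto_const_nhds (x := c)) hg (Or.inl hc)
    simpa using this
  have hup : Tendsto (fun N => c + g N) atTop (𝓝 c) := by
    have := (tendsto_const_nhds (x := c)).add hg
    simpa using this
  refine tendsto_of_tendsto_of_tendsto_of_le_of_le' hlow hup ?_ h2
  filter_upwards [h1] with N hN
  exact tsub_le_iff_right.2 hN

/-- **The finite-volume identity passes to the honest burnt set**: `μ2 (A_M) = P (B_M)`. -/
theorem measure_AM_eq_BM (p q : ℝ) (M : ℕ) (x : V3) :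
    μ2 (AM p q M x) = labelMeasure V3 (BM p q M x) := by
  set a : ℕ → ℝ≥0∞ := fun N => μ2 (AMN p q M N x) with ha
  set g : ℕ → ℝ≥0∞ := fun N =>
    ∑ y ∈ box 3 M, (labelMeasure V3 (TB p N y) - labelMeasure V3 (Burnt p y)) with hgdef
  have hg : Tendsto g atTop (𝓝 0) := tendsto_badBound p M
  -- two-field side
  have hA : Tendsto a atTop (𝓝 (μ2 (AM p q M x))) := by
    refine tendsto_of_abs_le (measure_ne_top _ _) hg ?_ ?_
    · filter_upwards [eventually_ge_atTop M] with N hN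
      calc μ2 (AM p q M x) ≤ μ2 (AMN p q M N x ∪ Prod.fst ⁻¹' (Good p M N)ᶜ) := by
              refine measure_mono fun π hπ => ?_
              by_cases hgood : π.1 ∈ Good p M N
              · exact Or.inl ((AM_iff_AMN_of_good hgood).1 hπ)
              · exact Or.inr hgood
        _ ≤ μ2 (AMN p q M N x) + μ2 (Prod.fst ⁻¹' (Good p M N)ᶜ) := measure_union_le _ _
        _ ≤ a N + g N := by
              rw [μ2_preimage_fst]
              exact add_le_add le_rfl (measure_compl_Good_le p hN)
    · filter_upwards [eventually_ge_atTop M] with N hN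
      calc a N ≤ μ2 (AM p q M x ∪ Prod.fst ⁻¹' (Good p M N)ᶜ) := by
              refine measure_mono fun π hπ => ?_
              by_cases hgood : π.1 ∈ Good p M N
              · exact Or.inl ((AM_iff_AMN_of_good hgood).2 hπ)
              · exact Or.inr hgood
        _ ≤ μ2 (AM p q M x) + μ2 (Prod.fst ⁻¹' (Good p M N)ᶜ) := measure_union_le _ _
        _ ≤ μ2 (AM p q M x) + g N := by
              rw [μ2_preimage_fst]
              exact add_le_add le_rfl (measure_compl_Good_le p hN)
  -- one-field side: the same sequence
  have hB : Tendsto a atTop (𝓝 (labelMeasure V3 (BM p q M x))) := by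
    have ha' : a = fun N => labelMeasure V3 (BMN p q M N x) := by
      funext N; exact measure_AMN_eq_BMN p q M N x
    rw [ha']
    refine tendsto_of_abs_le (measure_ne_top _ _) hg ?_ ?_
    · filter_upwards [eventually_ge_atTop M] with N hN
      calc labelMeasure V3 (BM p q M x) ≤ labelMeasure V3 (BMN p q M N x ∪ (Good p M N)ᶜ) := by
              refine measure_mono fun U hU => ?_
              by_cases hgood : U ∈ Good p M N
              · exact Or.inl ((BM_iff_BMN_of_good hgood).1 hU)
              · exact Or.inr hgood
        _ ≤ labelMeasure V3 (BMN p q M N x) + labelMeasure V3 (Good p M N)ᶜ := measure_union_le _ _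
        _ ≤ labelMeasure V3 (BMN p q M N x) + g N := add_le_add le_rfl (measure_compl_Good_le p hN)
    · filter_upwards [eventually_ge_atTop M] with N hN
      calc labelMeasure V3 (BMN p q M N x) ≤ labelMeasure V3 (BM p q M x ∪ (Good p M N)ᶜ) := by
              refine measure_mono fun U hU => ?_
              by_cases hgood : U ∈ Good p M N
              · exact Or.inl ((BM_iff_BMN_of_good hgood).2 hU)
              · exact Or.inr hgood
        _ ≤ labelMeasure V3 (BM p q M x) + labelMeasure V3 (Good p M N)ᶜ := measure_union_le _ _
        _ ≤ labelMeasure V3 (BM p q M x) + g N := add_le_add le_rfl (measure_compl_Good_le p hN)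
  exact tendsto_nhds_unique hA hB

/-- **The resampling identity for the reignition event** (`ShellIdentity` of the crux ideators, for
the event itself): the two-field (fresh) and one-field (same labels) reignition events have the same
probability, for ALL levels `p, q` and every root. -/
theorem measure_reignitesAt_eq_same (p q : ℝ) (x : V3) :
    μ2 (reignitesAt p q x) = labelMeasure V3 (sameReignitesAt p q x) := by
  obtain ⟨M₀, hM₀⟩ := exists_subset_box (Set.finite_singleton x)
  have hx : x ∈ box 3 M₀ := by simpa using hM₀ (mem_singleton x)
  -- both events are decreasing intersections of the finite-volume ones
  set sA : ℕ → Set (Lab × Lab) := fun k => AM p q (k + M₀) x with hsA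
  set sB : ℕ → Set Lab := fun k => BM p q (k + M₀) x with hsB
  have hωA : ∀ π : Lab × Lab, configOfLabels q π.2 (zdGraph 3) ∩ offE (burntSet p π.1) ⊆ (zdGraph 3).edgeSet :=
    fun π e he => he.1.1
  have hωB : ∀ U : Lab, sameVacant p q U ⊆ (zdGraph 3).edgeSet := fun U e he => he.1.1
  have hantiA : Antitone sA := by
    intro a b hab π hπ
    exact toBdry_anti (hωA π) (by omega) (box_mono 3 (by omega) hx) hπ
  have hantiB : Antitone sB := by
    intro a b hab U hU
    exact toBdry_anti (hωB U) (by omega) (box_mono 3 (by omega) hx) hU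
  have hinterA : ⋂ k, sA k = reignitesAt p q x := by
    ext π
    simp only [mem_iInter]
    constructor
    · intro h
      refine infinite_of_toBdry (n₀ := M₀) fun N hN => ?_
      have := h (N - M₀)
      simp only [hsA, AM, mem_setOf_eq] at this
      rw [Nat.sub_add_cancel hN] at this
      rwa [vacantFresh_eq]
    · intro hπ k
      have : (openCluster (configOfLabels q π.2 (zdGraph 3) ∩ offE (burntSet p π.1)) x).Infinite := by
        rwa [← vacantFresh_eq]
      exact toBdry_of_infinite (hωA π) (box_mono 3 (by omega) hx) this
  have hinterB : ⋂ k, sB k = sameReignitesAt p q x := by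
    ext U
    simp only [mem_iInter]
    constructor
    · intro h
      refine infinite_of_toBdry (n₀ := M₀) fun N hN => ?_
      have := h (N - M₀)
      simp only [hsB, BM, mem_setOf_eq] at this
      rwa [Nat.sub_add_cancel hN] at this
    · intro hU k
      exact toBdry_of_infinite (hωB U) (box_mono 3 (by omega) hx) hU
  have hlimA := tendsto_measure_iInter_atTop (μ := μ2)
    (fun k => (measurableSet_AM p q (k + M₀) x).nullMeasurableSet) hantiA ⟨0, measure_ne_top _ _⟩
  have hlimB := tendsto_measure_iInter_atTop (μ := labelMeasure V3)
    (fun k => (measurableSet_BM p q (k + M₀) x).nullMeasurableSet) hantiB ⟨0, measure_ne_top _ _⟩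
  rw [hinterA] at hlimA
  rw [hinterB] at hlimB
  have heq : (μ2 ∘ sA) = (labelMeasure V3 ∘ sB) := by
    funext k; exact measure_AM_eq_BM p q (k + M₀) x
  rw [heq] at hlimA
  exact tendsto_nhds_unique hlimA hlimB


/-- On and below the diagonal the SAME-field event is empty (a level-`q ≤ p` infinite path off
`I_p` would put its root into `I_p`). Second proof of the diagonal via the identity. -/
theorem sameReignitesAt_eq_empty_of_level_le {p q : ℝ} (hqp : q ≤ p) (x : V3) :
    sameReignitesAt p q x = ∅ := by
  ext U
  simp only [sameReignitesAt, mem_setOf_eq, mem_empty_iff_false, iff_false]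
  intro hinf
  have hsub : sameVacant p q U ⊆ configOfLabels p U (zdGraph 3) :=
    fun e he => configOfLabels_mono U (zdGraph 3) hqp he.1
  have hxB : x ∈ burntSet p U := (hinf.mono (openCluster_mono hsub x))
  -- the infinite cluster uses an edge at `x`, whose endpoints are off the burnt set
  obtain ⟨z, hz, hzx⟩ := Set.Infinite.nonempty (Set.Infinite.sdiff hinf (Set.finite_singleton x))
  obtain ⟨w⟩ := (hz : (openGraph (sameVacant p q U)).Reachable x z)
  cases w with
  | nil => exact hzx rfl
  | cons h _ =>
    rw [openGraph_adj] at h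
    exact h.1.2 x (Sym2.mem_mk_left _ _) hxB

/-- **Witness window.** `VacantReignition` ⟺ for every `ε > 0` some environment level
`p ∈ (p_c, p_c + ε)` reignites at field level `p_c + ε` (levels `p ≥ p_c + ε` are null by
`reignites_null_of_level_le`). -/
theorem vacantReignition_iff_window :
    VacantReignition ↔ ∀ ε : ℝ, 0 < ε → ∃ p : ℝ, pc < p ∧ p < pc + ε ∧
      0 < μ2.real (reignites p (pc + ε)) := by
  rw [vacantReignition_iff]
  refine ⟨fun h ε hε => ?_, fun h ε hε => ?_⟩
  · obtain ⟨p, hp, hpos⟩ := h ε hε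
    refine ⟨p, hp, ?_, hpos⟩
    by_contra hle
    have h0 := reignites_null_of_level_le (not_lt.1 hle)
    simp [measureReal_def, h0] at hpos
  · obtain ⟨p, hp, -, hpos⟩ := h ε hε
    exact ⟨p, hp, hpos⟩

/-- **Any proof must take `p < p_c + ε`**: the variant of the crux demanding a witness
`p ≥ p_c + ε` is false (the diagonal and everything below it is null). -/
theorem vacantReignition_false_without_window :
    ¬ (∀ ε : ℝ, 0 < ε → ∃ p : ℝ, pc + ε ≤ p ∧ 0 < μ2.real (reignites p (pc + ε))) := by
  intro h
  obtain ⟨p, hp, hpos⟩ := h 1 one_pos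
  have h0 := reignites_null_of_level_le hp
  simp [measureReal_def, h0] at hpos

/-- **`JumpFireBreak`'s conclusion at `ε = 0`, unconditionally**: with environment AND field at
`p_c`, almost surely no vertex percolates in the vacant fresh configuration (`p_c(ℤ³ ∖ I_{p_c}) ≥ p_c`).
Item stmt-CriticalPhenomena-7204 is therefore exactly the STRICT increment `ε > 0`. -/
theorem jumpFireBreak_conclusion_at_eps_zero :
    μ2 {π | ∃ x : V3, (openCluster (vacantFresh pc pc π) x).Infinite} = 0 :=
  vacantFresh_noPercolation_of_level_le le_rfl

/-- **One-field form of the crux (ADKS Thm 2, `d = 3`, vertex-deleted, rooted).** By the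
resampling identity the fresh field may be replaced by the environment's own labels:
`VacantReignition ⟺ ∀ ε > 0 ∃ p > p_c, P(0 ↔ ∞ in ω_{p_c+ε} off the vertices of C_∞(ω_p)) > 0`. -/
theorem vacantReignition_iff_sameField :
    VacantReignition ↔ ∀ ε : ℝ, 0 < ε → ∃ p : ℝ, pc < p ∧
      0 < (labelMeasure V3).real (sameReignitesAt p (pc + ε) 0) := by
  rw [vacantReignition_iff]
  have key : ∀ p q : ℝ, μ2.real (reignites p q) = (labelMeasure V3).real (sameReignitesAt p q 0) := by
    intro p q
    rw [measureReal_def, measureReal_def, reignites_eq_reignitesAt, measure_reignitesAt_eq_same]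
  simp_rw [key]

end Summit.CriticalPhenomena.PercolationContinuityZ3.Cruxes.VacantReignition.Disproof

end
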